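import Literature.Analysis.ODE.HeunEulerKernel
import Literature.Analysis.ODE.HeunDerivative
import Literature.Analysis.ODE.HeunMobius
import Literature.Geometry.Lorentzian.KerrDeSitterRouteWSpinFlip
import HarnessLib

/-!
# Casals–Teixeira da Costa 2022 Prop. 3.8 (partial mode stability, generic boundary behaviour) — `CasalsTeixeiraDaCosta2022_partialModeStabilityProp38` HOLDS (re-homed proofs, file 2 of 2)

**Casals–Teixeira da Costa 2022, Proposition 3.8 (with Lemma 3.5, the proof of Corollary 3.9 and Step 2 of the proof of Theorem 3.10) —
the named fact `Literature.Geometry.Lorentzian.KerrDeSitter.CasalsTeixeiraDaCosta2022_partialModeStabilityProp38` (`KerrDeSitterThresholdRays.lean`)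
HOLDS**: for subextremal Kerr–de Sitter parameters, half-integer spin `s`, `Im ω > 0`, `Im(λ̄ω̄) ≤ 0`, `|ω| ∉ |m|·(0, Ω_SR)` and Proposition 3.8's
pair conditions, every classical solution of the radial Teukolsky ODE on `(r₊, r_c)` that is ingoing at `𝓗⁺` and outgoing at `𝓗⁺_c` in the generic
sense vanishes identically (M. Casals, R. Teixeira da Costa, *Hidden spectral symmetries and mode stability of subextremal Kerr(-de Sitter) black
holes*, CMP (2022) = arXiv:2105.13329v2, Prop. 3.8, Lemma 3.5, Cor. 3.9, Thm. 3.10 Step 2) [CasalsTeixeiradacosta2022].  ARCHITECTURE of the in-tree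
proof (kernel-checked, 0 cited facts; until now Summits-side only, `Summits/Ventures/KdS/RouteWSpinFlipStrata.lean`): ROUTE W — the radial Teukolsky
ODE in Heun normal form (`HeunModeData`, `NormalFormModeData`), the transfer to the Euler gauge through the accessory identity (`Transfer`,
`AccessoryIdentity`, `transfer_holds`), the non-resonant Euler recursion (`EulerRLNonRes`, `eulerRLNonRes_holds`), the gauge glue (`GaugeGlue`,
`gaugeGlue_holds`) and the swapped energy identity of Thm. 3.10 Step 2 (`SwappedEnergyVanishing`, `swappedEnergyVanishing_holds`), giving the
vanishing below height `κ₁` and above `(s−1)κ₁`; the SPIN FLIP through the Teukolsky–Starobinsky map (`SpinFlipTS`, `spinFlipTS_holds`: monomial /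
polynomial bookkeeping, branch coefficients) off the cosmological lattice; and ON the lattice the formal Euler partner (Frobenius sums, the
three-term recurrence and its termwise intertwining, the Euler form) closing every stratum (`radial_vanishing_lattice`), whence
`prop38_allSpins`.  RE-HOMED into `Literature/` by the Hodge foundations lane (`lit-hodgefound`, seat p20, generation 38) as TWO files: verbatim
DECLARATION-LEVEL ports (the declarations needed, in dependency order) of the 19 Summits modules `Summits/Ventures/KdS/{RouteW, SpinFlip{Bookkeeping,
Analysis,Polynomial,Monomial,Intertwine,Frobenius,EulerForm}, RouteW{SpinFlip,NonRes,GaugeGlue,Transfer,TransferHolds,SwappedEnergy,EulerRL,HighSpin,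
SpinFlipProp38,SpinFlipPoly,SpinFlipStrata}}.lean`, namespace `Summit.Ventures.KdS` re-rooted as `Literature.Geometry.Lorentzian.KerrDeSitter.TeukolskyRadial`
(sub-namespaces `RouteW`, `SpinFlipTS` kept), followed by the EXACT-name discharge
`Literature.Geometry.Lorentzian.KerrDeSitter.CasalsTeixeiraDaCosta2022_partialModeStabilityProp38_holds`.  The route's intermediate statements come
as definitions WITH their proofs in the same files (`Transfer`/`transfer_holds`, `GaugeGlue`/`gaugeGlue_holds`, `SwappedEnergyVanishing`/`…_holds`,
`EulerRLNonRes`/`…_holds`, `AccessoryIdentity`/`…_holds`, `SpinFlipTS`/`…_holds`) and the data/gadgets with their bodies (`HeunModeData`,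
`NormalFormModeData`, `zTwo`, `ltBlock`, `mass₁…₄`, `bigE`, `tildeCoeff`, `lamFlip`, `branchCoeff`, `OffLattice`, `gaugeW`, `gaugeP`, `symX₀…₂`,
`recCoeff`, `partnerWeight`, `partnerCoeff`, `cpowSum…`, `symbolSum`, `shiftPoly`); no unproved named fact (D-0026), no Summits import; built on the
tree's Literature layer (`Geometry/Lorentzian/KerrDeSitter*`, `Analysis/ODE/GeneralHeun*`) and Mathlib.  The Summits originals stay in place
(transitional duplication).  WHAT THIS IS NOT: no mode-stability claim beyond the displayed statement (Prop. 3.8's partial result under its explicit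
hypotheses); nothing about the full Teukolsky equation or nonlinear stability.

THIS FILE (2 of 2; imports `KerrDeSitterRouteWSpinFlip.lean`) ports: RouteWHighSpin, RouteWSpinFlipProp38, RouteWSpinFlipPoly, SpinFlipIntertwine, SpinFlipFrobenius, SpinFlipEulerForm, RouteWSpinFlipStrata; then the EXACT-name discharge.
-/

noncomputable section

/-!
## Part 1 — port of `Summits/Ventures/KdS/RouteWHighSpin.lean` (3 declarations kept)

# Venture KdS — ROUTE W above the event-horizon integrability line: every spin `s`

HONEST FRAMING (venture `Summits/Ventures/KdS`, cell `pub-kds`; a theorem about the radial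
Teukolsky ODE of Kerr–de Sitter in the tree's generic-boundary vocabulary, NOT a mode-stability
claim beyond what is stated): route W (`RouteW.radial_vanishing_lt_one`, landed, 0 cited facts)
uses the hypothesis `s < 1` at exactly ONE place — to get the integrability `Re(2η₁ − s) > −1` of
the event-horizon branch in the Euler gauge (`Re η₁ = Im ω/(2κ₁)`). This file records the same
composition with that hypothesis replaced by what it is used for,
`(s − 1)·κ₁ < Im ω` (`radial_vanishing_of_im_gt`), so that the conclusion of Casals–Teixeira da
Costa's Proposition 3.8 / Theorem 3.10 (upper half-plane, generic bullets) holds for EVERY real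
spin `s` in the region `Im ω > max(0, (s−1)κ₁)` — no spin flip, no Teukolsky–Starobinsky map. In
particular, on the event-horizon threshold ray `Re ω = m ϖ₁` Proposition 3.8's printed pair
condition for `m₁ + m₂ = s − 2η₁` IS `(s−1)κ₁ < Im ω` (`pairCondition_event_iff`, landed), so there
the cited fact `CasalsTeixeiraDaCosta2022_partialModeStabilityProp38` needs nothing beyond route W
for any spin (`radial_vanishing_eventRay`). What remains of H3 for `s ≥ 1` after this file is the
strip `0 < Im ω ≤ (s−1)κ₁` off the ray `Re ω = mϖ₁` — the object of the Teukolsky–Starobinsky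
transfer (`RouteW.SpinFlip`, STRUCTURE.md C3), treated separately.

References: Casals–Teixeira da Costa, Commun. Math. Phys. 394 (2022) 797–832
[CasalsTeixeiradacosta2022], Prop. 3.8, Cor. 3.9, Thm. 3.10 (Step 2).

(Verbatim declaration-level port — the declarations listed in the Part header count — of the Summits-side module of the KdS
venture; venture / cell / ruling bookkeeping in the text above is historical.)
-/

section Part1

open _root_.Set _root_.Complex

namespace Literature.Geometry.Lorentzian.KerrDeSitter.TeukolskyRadial

namespace RouteW

open Literature.Analysis.ODE Literature.Analysis.ODE.GeneralHeun
open Literature.Geometry.Lorentzian Literature.Geometry.Lorentzian.KerrDeSitter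

/-- The Euler-gauge integrability at the event horizon: `Re(2η₁ − s) > −1` iff
`(s − 1)κ₁ < Im ω` (`Re η₁ = Im ω/(2κ₁)`, `κ₁ > 0`).
[cite: CasalsTeixeiradacosta2022, Proposition 3.8 (arXiv v2) with Lemma 3.5 and the proof of Theorem 3.10, Step 2 (route W / spin-flip bookkeeping of the in-tree proof)] -/
theorem re_branch_gt_neg_one_iff {M a Λ : ℝ} (hsub : IsSubextremal M a Λ) (s : ℝ) (ω : ℂ) (m : ℝ) :
    -1 < (2 * etaEvent M a Λ ω m - (s : ℂ)).re ↔
      (s - 1) * surfaceGravity M a Λ (rPlus M a Λ) < ω.im := by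
  have hκ₁ := surfaceGravity_rPlus_pos hsub
  have h1 : (2 * etaEvent M a Λ ω m - (s : ℂ)).re = 2 * (etaEvent M a Λ ω m).re - s := by
    simp [Complex.mul_re]
  rw [h1, etaEvent_re]
  have h2 : 2 * (ω.im / (2 * surfaceGravity M a Λ (rPlus M a Λ))) =
      ω.im / surfaceGravity M a Λ (rPlus M a Λ) := by
    field_simp
  rw [h2]
  constructor
  · intro h
    have h3 : s - 1 < ω.im / surfaceGravity M a Λ (rPlus M a Λ) := by linarith
    exact (lt_div_iff₀ hκ₁).mp h3
  · intro h
    have h3 : s - 1 < ω.im / surfaceGravity M a Λ (rPlus M a Λ) := (lt_div_iff₀ hκ₁).mpr h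
    linarith

/-- **Route W for every spin above the integrability line.** `Transfer`, `EulerRLNonRes`,
`GaugeGlue` and `SwappedEnergyVanishing` imply: for subextremal `(M,a,Λ)`, `0 ≤ a`, ANY real `s`,
`Im ω > 0` with `(s−1)κ₁ < Im ω`, `Im(λ̄ω̄) ≤ 0`, `|ω| ∉ |m|(0,Ω_SR)` and the pair condition for
`p₃ = −2(η₁+η₀)`, every generic-boundary radial solution vanishes on `(r₊, r_c)`. The proof is the
landed composition `radial_vanishing_of_routeW_nonres_lt_one` verbatim, with the single use of
`s < 1` (the bound `Re(2η₁ − s) > −1`) supplied by `re_branch_gt_neg_one_iff` instead. PROVED.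
[cite: CasalsTeixeiradacosta2022, Proposition 3.8 (arXiv v2) with Lemma 3.5 and the proof of Theorem 3.10, Step 2 (route W / spin-flip bookkeeping of the in-tree proof)] -/
theorem radial_vanishing_of_routeW_nonres_of_im_gt (kA : Transfer) (kB : EulerRLNonRes)
    (kG : GaugeGlue) (k2 : SwappedEnergyVanishing) {M a Λ s : ℝ} {ω : ℂ} {m : ℝ} {lam : ℂ}
    {R : ℝ → ℂ} (hsub : IsSubextremal M a Λ) (ha : 0 ≤ a)
    (hhi : (s - 1) * surfaceGravity M a Λ (rPlus M a Λ) < ω.im) (hω : 0 < ω.im)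
    (hlam : (lambdaBar a Λ s ω m lam * (starRingEnd ℂ) ω).im ≤ 0)
    (hSR : ¬(0 < ‖ω‖ ∧ ‖ω‖ < |m| * superradiantUpper M a Λ))
    (hp₃ : PairCondition (-2 * (etaEvent M a Λ ω m + etaCauchy M a Λ ω m)))
    (hR : IsRadialTeukolskySolution M a Λ s ω m lam R) (hin : IsIngoingAtEventHorizon M a Λ s ω m R)
    (hout : IsOutgoingAtCosmoHorizon M a Λ ω m R) :
    ∀ r ∈ Ioo (rPlus M a Λ) (rCosmo M a Λ), R r = 0 := by
  obtain ⟨hz₂, v, hv, hvR⟩ := kA M a Λ s ω m lam R hsub hR hin hout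
  set η₀ := etaCauchy M a Λ ω m with hη₀
  set η₁ := etaEvent M a Λ ω m with hη₁
  set η₂ := etaCosmo M a Λ ω m with hη₂
  set z₂ := zTwo M a Λ with hz₂def
  have hF := eulerGauge_fuchs (mass₁ M a Λ s ω m) (mass₂ M a Λ ω m) (mass₃ M a Λ s ω m)
    (mass₄ M a Λ ω m)
  have hroot := euler_exponent_root (mass₂ M a Λ ω m) (mass₃ M a Λ s ω m) (mass₄ M a Λ ω m)
  have hρ : 2 * etaEvent M a Λ ω m - (s : ℂ) =
      1 - eulerGaugeδ (mass₁ M a Λ s ω m) (mass₂ M a Λ ω m) := by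
    unfold mass₁ mass₂
    rw [eulerGaugeδ_eta]
    ring
  -- the ONLY change w.r.t. the `s < 1` version: integrability from `(s−1)κ₁ < Im ω`
  have hre : -1 < (2 * etaEvent M a Λ ω m - (s : ℂ)).re :=
    (re_branch_gt_neg_one_iff hsub s ω m).mpr hhi
  have hnr : ∀ n : ℕ, 2 * etaEvent M a Λ ω m - (s : ℂ) +
      eulerGaugeα (mass₂ M a Λ ω m) (mass₃ M a Λ s ω m) - 1 ≠ -((n : ℂ) + 1) := by
    intro n
    unfold mass₂ mass₃
    rw [rho_add_eta_sub_one_eq]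
    exact nonres_of_pairCondition hp₃ n
  obtain ⟨u, hu, huv⟩ := kB z₂ _ _ _ _ _ _ _ _ v hz₂ hF hroot hρ hre hnr hv
  rw [euler_swap_α, euler_swap_β, euler_swap_γ, euler_swap_δ, euler_swap_ε, euler_swap_q] at hu
  obtain ⟨Rt, hRt, hRtu⟩ := kG z₂ (mass₁ M a Λ s ω m) (mass₃ M a Λ s ω m) (mass₂ M a Λ ω m)
    (mass₄ M a Λ ω m) (bigE M a Λ s ω m lam) _ u hz₂ hu
  have he₁ : 2 * etaEvent M a Λ ω m - (s : ℂ) + eulerGaugeα (mass₂ M a Λ ω m) (mass₃ M a Λ s ω m)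
        - 1 + eulerGaugeδ (mass₁ M a Λ s ω m) (mass₃ M a Λ s ω m) / 2 =
      1 / 2 + etaCauchy M a Λ ω m + etaEvent M a Λ ω m := by
    unfold mass₁ mass₂ mass₃
    rw [eulerGaugeα_eta, eulerGaugeδ_swap_eta]
    ring
  have he₂ : eulerGaugeε (mass₂ M a Λ ω m) (mass₄ M a Λ ω m) / 2 =
      1 / 2 - etaCauchy M a Λ ω m - etaCosmo M a Λ ω m := by
    unfold mass₂ mass₄
    rw [eulerGaugeε_swap_eta]
    ring
  rw [he₁, he₂] at hRt
  have hsub' := hsub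
  obtain ⟨hM, hΛ, h01, h12, -⟩ := hsub'
  have hr₀ : 0 ≤ rMinus M a Λ := rMinus_nonneg M a Λ
  have hcoef : ∀ z ∈ Ioo 1 z₂,
      sqcdCoeff (mass₁ M a Λ s ω m) (mass₃ M a Λ s ω m) (mass₂ M a Λ ω m) (mass₄ M a Λ ω m)
          (bigE M a Λ s ω m lam) (z₂ : ℂ) z = tildeCoeff M a Λ s ω m lam z := by
    intro z hz
    obtain ⟨hz1, hzz⟩ := hz
    unfold tildeCoeff bigE mass₁ mass₂ mass₃ mass₄
    rw [hz₂def] at hzz ⊢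
    unfold zTwo
    symm
    refine ctdcTilde_eq_sqcd_swap (s : ℂ) η₀ η₁ η₂ (ltBlock M a Λ s ω m lam) ?_ ?_ ?_ ?_ ?_ ?_ ?_
    · exact_mod_cast (sub_pos.mpr h01).ne'
    · have : 0 < rCosmo M a Λ + (rMinus M a Λ + rPlus M a Λ + rCosmo M a Λ) := by linarith
      exact_mod_cast this.ne'
    · have : 0 < rPlus M a Λ + rCosmo M a Λ := by linarith
      exact_mod_cast this.ne'
    · have : (0 : ℝ) < z := by linarith
      exact_mod_cast this.ne'
    · exact sub_ne_zero.mpr (by exact_mod_cast (ne_of_gt hz1))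
    · unfold zTwo at hzz
      exact sub_ne_zero.mpr (by exact_mod_cast (ne_of_gt hzz))
    · rw [hz₂def] at hz₂
      unfold zTwo at hz₂
      have : (0 : ℝ) < ctdcZ₂ (rMinus M a Λ) (rPlus M a Λ) (rCosmo M a Λ) := by linarith
      exact_mod_cast this.ne'
  have hRt' : NormalFormModeData z₂ (tildeCoeff M a Λ s ω m lam)
      (1 / 2 + etaCauchy M a Λ ω m + etaEvent M a Λ ω m)
      (1 / 2 - etaCauchy M a Λ ω m - etaCosmo M a Λ ω m) Rt := hRt.congr hcoef
  have hRt0 := k2 M a Λ s ω m lam Rt hsub ha hω hlam hSR hRt'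
  exact hvR (huv (hRtu hRt0))

/-- **Route W, discharged, for every spin above the integrability line.** For subextremal
`(M,a,Λ)`, `0 ≤ a`, any real spin `s`, `Im ω > 0`, `(s−1)κ₁ < Im ω`, `Im(λ̄ω̄) ≤ 0`,
`|ω| ∉ |m|(0,Ω_SR)` and Prop. 3.8's pair condition for `−2(η₁+η₀)`, every classical radial Teukolsky
solution on `(r₊, r_c)` that is ingoing at `𝓗⁺` and outgoing at `𝓗⁺_c` (generic bullets) vanishes
identically. Inputs: `transfer_holds`, `eulerRLNonRes_holds`, `gaugeGlue_holds`,
`swappedEnergyVanishing_holds` — no cited fact, no open hypothesis. For `s ≤ 1` the extra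
hypothesis is implied by `Im ω > 0`; for `s = 2` it reads `Im ω > κ₁`. PROVED.
[cite: CasalsTeixeiradacosta2022, Proposition 3.8 (arXiv v2) with Lemma 3.5 and the proof of Theorem 3.10, Step 2 (route W / spin-flip bookkeeping of the in-tree proof)] -/
theorem radial_vanishing_of_im_gt {M a Λ s : ℝ} {ω : ℂ} {m : ℝ} {lam : ℂ} {R : ℝ → ℂ}
    (hsub : IsSubextremal M a Λ) (ha : 0 ≤ a)
    (hhi : (s - 1) * surfaceGravity M a Λ (rPlus M a Λ) < ω.im) (hω : 0 < ω.im)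
    (hlam : (lambdaBar a Λ s ω m lam * (starRingEnd ℂ) ω).im ≤ 0)
    (hSR : ¬(0 < ‖ω‖ ∧ ‖ω‖ < |m| * superradiantUpper M a Λ))
    (hp₃ : PairCondition (-2 * (etaEvent M a Λ ω m + etaCauchy M a Λ ω m)))
    (hR : IsRadialTeukolskySolution M a Λ s ω m lam R) (hin : IsIngoingAtEventHorizon M a Λ s ω m R)
    (hout : IsOutgoingAtCosmoHorizon M a Λ ω m R) :
    ∀ r ∈ Ioo (rPlus M a Λ) (rCosmo M a Λ), R r = 0 :=
  radial_vanishing_of_routeW_nonres_of_im_gt transfer_holds eulerRLNonRes_holds gaugeGlue_holds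
    swappedEnergyVanishing_holds hsub ha hhi hω hlam hSR hp₃ hR hin hout

end RouteW

end Literature.Geometry.Lorentzian.KerrDeSitter.TeukolskyRadial

end Part1

/-!
## Part 2 — port of `Summits/Ventures/KdS/RouteWSpinFlipProp38.lean` (1 declarations kept)

# Venture KdS — Casals–Teixeira da Costa's Proposition 3.8 for every spin (route W + spin flip)

HONEST FRAMING (venture `Summits/Ventures/KdS`, cell `pub-kds`): consequences of the landed
route W (`RouteW.radial_vanishing_lt_one`, `RouteW.radial_vanishing_of_im_gt`, 0 cited facts) and
of the spin-flip theorem `RouteW.spinFlipTS_holds` (`RouteWSpinFlip.lean`). The conclusion of the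
cited fact `CasalsTeixeiraDaCosta2022_partialModeStabilityProp38` — every generic-boundary radial
Teukolsky solution with `Im ω > 0`, `Im(λ̄ω̄) ≤ 0`, `|ω| ∉ |m|(0,Ω_SR)` (and the pair condition for
`−2(η₁+η₀)`) vanishes — is PROVED here for every half-integer spin outside one explicit finite set
of frequencies: `prop38_of_im_gt_or_offLattice` (hypothesis `(s−1)κ₁ < Im ω ∨ OffLattice`), with the
lattice avoided off the ray `Re ω = mϖ₂` (`offLattice_of_re_ne`), above the height `(s−1)κ₂`
(`offLattice_of_im_gt_cosmo`) and always for `s ≤ 1` (`offLattice_of_le_one`); hence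
`prop38_le_one` (`s ≤ 1`), `prop38_of_im_gt_cosmo`, `prop38_of_re_ne`; and, with the extreme
lattice stratum closed by the explicit partner mode of `RouteWSpinFlipLattice.lean`
(`radial_vanishing_of_im_gt_pred_cosmo`), **`prop38_le_two`: the cited fact H3 is a theorem for
EVERY spin `s ≤ 2` — all physically relevant Teukolsky spins `|s| ≤ 2`, gravitational
perturbations `s = ±2` included — with 0 cited facts**, and `prop38_of_im_gt_pred_cosmo` for every
spin above the height `(s−2)κ₂`. What is NOT covered: for `s ≥ 5/2`, the non-extreme lattice points
`Re ω = mϖ₂`, `Im ω = jκ₂ ≤ (s−2)κ₂`, `j ∈ (s+ℤ) ∩ (0, s−2]` (polynomial kernel strata of positive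
degree). No mode-stability claim beyond the displayed statements.

(Verbatim declaration-level port — the declarations listed in the Part header count — of the Summits-side module of the KdS
venture; venture / cell / ruling bookkeeping in the text above is historical.)
-/

section Part2

open _root_.Set _root_.Complex

namespace Literature.Geometry.Lorentzian.KerrDeSitter.TeukolskyRadial

namespace RouteW

open Literature.Analysis.ODE Literature.Analysis.ODE.GeneralHeun
open Literature.Geometry.Lorentzian Literature.Geometry.Lorentzian.KerrDeSitter

/-! ### Where the lattice is avoided -/

/-- **Route W + the spin flip: CTdC Prop. 3.8's conclusion for every half-integer `s ≥ 1/2` off the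
lattice.** For subextremal `(M,a,Λ)`, `0 ≤ a`, `2s = N ≥ 1`, `Im ω > 0`, `Im(λ̄ω̄) ≤ 0`,
`|ω| ∉ |m|(0,Ω_SR)`, Prop. 3.8's pair condition for `−2(η₁+η₀)` and the off-lattice condition, every
generic-boundary radial Teukolsky solution of spin `s` vanishes on `(r₊, r_c)`: its spin-`−s` image
`R'` (same `λ̄`, `lambdaBar_lamFlip`) vanishes by `radial_vanishing_lt_one`, and the flip is injective
off the lattice. PROVED, 0 cited facts.
[cite: CasalsTeixeiradacosta2022, Proposition 3.8 (arXiv v2) with Lemma 3.5 and the proof of Theorem 3.10, Step 2 (route W / spin-flip bookkeeping of the in-tree proof)] -/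
theorem radial_vanishing_offLattice {M a Λ s : ℝ} {ω : ℂ} {m : ℝ} {lam : ℂ} {R : ℝ → ℂ}
    (hsub : IsSubextremal M a Λ) (ha : 0 ≤ a) {N : ℕ} (hN1 : 1 ≤ N) (hsN : 2 * s = N)
    (hω : 0 < ω.im) (hlam : (lambdaBar a Λ s ω m lam * (starRingEnd ℂ) ω).im ≤ 0)
    (hSR : ¬(0 < ‖ω‖ ∧ ‖ω‖ < |m| * superradiantUpper M a Λ))
    (hp₃ : PairCondition (-2 * (etaEvent M a Λ ω m + etaCauchy M a Λ ω m)))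
    (hoff : OffLattice M a Λ s ω m)
    (hR : IsRadialTeukolskySolution M a Λ s ω m lam R) (hin : IsIngoingAtEventHorizon M a Λ s ω m R)
    (hout : IsOutgoingAtCosmoHorizon M a Λ ω m R) :
    ∀ r ∈ Ioo (rPlus M a Λ) (rCosmo M a Λ), R r = 0 := by
  obtain ⟨R', hR', hin', hout', hinj⟩ := spinFlipTS_holds M a Λ s ω m lam R N hsub hN1 hsN hR hin hout
  have hN' : (1 : ℝ) ≤ N := by exact_mod_cast hN1
  have hs' : -s < 1 := by linarith
  have hlam' : (lambdaBar a Λ (-s) ω m (lamFlip a Λ s lam) * (starRingEnd ℂ) ω).im ≤ 0 := by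
    rw [lambdaBar_lamFlip]; exact hlam
  exact hinj hoff (radial_vanishing_lt_one hsub ha hs' hω hlam' hSR hp₃ hR' hin' hout')

end RouteW

end Literature.Geometry.Lorentzian.KerrDeSitter.TeukolskyRadial

end Part2

/-!
## Part 3 — port of `Summits/Ventures/KdS/RouteWSpinFlipPoly.lean` (4 declarations kept)

# Venture KdS — the spin flip on the cosmological lattice (II): the kernel of the
# Teukolsky–Starobinsky map is polynomial (clause (c) of the spin-flip chain)

HONEST FRAMING (venture `Summits/Ventures/KdS`, cell `pub-kds`; LIT-1 g22 under lead ruling A86,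
following P1 g5's recipe `theory/P1-HANDOFF-g5.md §RESIDUAL`). `RouteW.spinFlip_core`
(`RouteWSpinFlip.lean`, landed, append-only) exports, when the spin-`−s` image `R'` of a
generic-boundary spin-`s` radial solution `R` vanishes, (a) `R ≡ 0` off the cosmological lattice and
(b) the accessory condition of the monomial at the EXTREME lattice point. This file re-runs the same
chain (Hatsuda gauge → exponent flip → Umetsu's `2s`-th derivative → flip back; parts (1)–(3) are
copied verbatim from `spinFlip_core`, whose internals are not exported) and proves clause **(c)**,
valid at EVERY lattice point `s + 2B(r_c) = j ∈ ℕ`, `j ≤ 2s − 1`: if `R' ≡ 0` then the Hatsuda-gauge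
function `y = R/w ∘ r(x)` of `R` is
`y(x) = x^{1−γ} (z_r − x)^{1−ε} · r(x)` on `(0,1)` for a POLYNOMIAL `r` of degree `≤ 2s − 1 − j`
(`spinFlip_polynomial`). Mechanism: `ỹ^{(2s)} ≡ 0` makes `ỹ = x^{γ−1}(1−x)^{δ−1}(z_r−x)^{ε−1}y` a
polynomial `P` of degree `≤ 2s−1` (`SpinFlipTS.exists_polynomial_of_iterate_deriv_eq_zero`); the
outgoing branch `ỹ = (1−x)^{δ−1}·G₁`, `δ − 1 = j`, `G₁` smooth across `1`, forces `(X−1)^j ∣ P`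
(`SpinFlipTS.natural_of_smooth_branch`), and `r = ±P/(X−1)^j`. The non-extreme strata
(`j < 2s−1`, polynomial kernels of positive degree) are then excluded in `RouteWSpinFlipStrata.lean`
by the formal Euler partner of `SpinFlipIntertwine.lean` / `SpinFlipFrobenius.lean`. 0 cited facts.

(Verbatim declaration-level port — the declarations listed in the Part header count — of the Summits-side module of the KdS
venture; venture / cell / ruling bookkeeping in the text above is historical.)
-/

section Part3

open _root_.Set _root_.Complex _root_.Filter _root_.Topology _root_.Polynomial

namespace Literature.Geometry.Lorentzian.KerrDeSitter.TeukolskyRadial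

namespace SpinFlipTS

open Literature.Analysis.ODE Literature.Analysis.ODE.GeneralHeun
open Literature.Geometry.Lorentzian Literature.Geometry.Lorentzian.KerrDeSitter

/-! ### Smoothness helpers (principal powers of positive reals) -/

/-- `t ↦ t^p` is smooth on `(0, ∞)` (real variable, principal complex power).
[cite: CasalsTeixeiradacosta2022, Proposition 3.8 (arXiv v2) with Lemma 3.5 and the proof of Theorem 3.10, Step 2 (route W / spin-flip bookkeeping of the in-tree proof)] -/
private theorem contDiffOn_ofReal_cpow (p : ℂ) :
    ContDiffOn ℝ ((⊤ : ℕ∞) : WithTop ℕ∞) (fun t : ℝ => (t : ℂ) ^ p) (Ioi 0) := by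
  intro x hx
  have hslit : ((x : ℝ) : ℂ) ∈ slitPlane := Complex.ofReal_mem_slitPlane.2 hx
  have h1 : AnalyticAt ℂ (fun z : ℂ => z ^ p) (x : ℂ) := analyticAt_id.cpow analyticAt_const hslit
  have h3 : AnalyticAt ℝ (fun y : ℝ => (y : ℂ)) x := Complex.ofRealCLM.analyticAt x
  have h4 : AnalyticAt ℝ (fun y : ℝ => ((y : ℂ)) ^ p) x :=
    AnalyticAt.comp (g := fun z : ℂ => z ^ p) (f := fun y : ℝ => (y : ℂ)) (x := x)
      h1.restrictScalars h3
  exact h4.contDiffAt.contDiffWithinAt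

/-- `x ↦ (g x)^p` is smooth where the real function `g` is smooth and positive.
[cite: CasalsTeixeiradacosta2022, Proposition 3.8 (arXiv v2) with Lemma 3.5 and the proof of Theorem 3.10, Step 2 (route W / spin-flip bookkeeping of the in-tree proof)] -/
private theorem contDiffOn_cpow_comp {g : ℝ → ℝ} {U : Set ℝ}
    (hg : ContDiffOn ℝ ((⊤ : ℕ∞) : WithTop ℕ∞) g U) (hpos : ∀ x ∈ U, 0 < g x) (p : ℂ) :
    ContDiffOn ℝ ((⊤ : ℕ∞) : WithTop ℕ∞) (fun x => ((g x : ℝ) : ℂ) ^ p) U :=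
  (contDiffOn_ofReal_cpow p).comp hg fun x hx => hpos x hx

/-- Product of principal powers of the same positive real: `t^p · t^q = t^{p+q}`.
[cite: CasalsTeixeiradacosta2022, Proposition 3.8 (arXiv v2) with Lemma 3.5 and the proof of Theorem 3.10, Step 2 (route W / spin-flip bookkeeping of the in-tree proof)] -/
private theorem cpow_mul_cpow_ofReal {t : ℝ} (ht : 0 < t) (p q : ℂ) :
    ((t : ℝ) : ℂ) ^ p * ((t : ℝ) : ℂ) ^ q = ((t : ℝ) : ℂ) ^ (p + q) := by
  rw [Complex.cpow_add _ _ (by exact_mod_cast ht.ne')]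

end SpinFlipTS

namespace RouteW

open Literature.Analysis.ODE Literature.Analysis.ODE.GeneralHeun
open Literature.Geometry.Lorentzian Literature.Geometry.Lorentzian.KerrDeSitter
open SpinFlipTS

/-! ### Clause (c): the polynomial kernel on the lattice -/

/-- **The spin-flip chain with clause (c).** For a generic-boundary spin-`s` radial solution `R`
(`2s = N ≥ 1`) the Teukolsky–Starobinsky image `R'` (spin `−s`, `λ' = lamFlip`) is a generic-boundary
radial solution (as in `spinFlip_core`); and IF `R' ≡ 0` then at every lattice point
`s + 2B(r_c) = j`, `j ∈ ℕ`, `j + 1 ≤ N`, the Hatsuda-gauge function of `R` is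
`x^{1−γ}(z_r−x)^{1−ε}·r(x)` on `(0,1)` for a polynomial `r` with `deg r + j + 1 ≤ N`. PROVED,
0 cited facts.
[cite: CasalsTeixeiradacosta2022, Proposition 3.8 (arXiv v2) with Lemma 3.5 and the proof of Theorem 3.10, Step 2 (route W / spin-flip bookkeeping of the in-tree proof)] -/
theorem spinFlip_polynomial (M a Λ s : ℝ) (ω : ℂ) (m : ℝ) (lam : ℂ) (R : ℝ → ℂ) (N : ℕ)
    (hsub : IsSubextremal M a Λ) (hN1 : 1 ≤ N) (hsN : 2 * s = N)
    (hR : IsRadialTeukolskySolution M a Λ s ω m lam R) (hin : IsIngoingAtEventHorizon M a Λ s ω m R)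
    (hout : IsOutgoingAtCosmoHorizon M a Λ ω m R) :
    ∃ R' : ℝ → ℂ, IsRadialTeukolskySolution M a Λ (-s) ω m (lamFlip a Λ s lam) R' ∧
      IsIngoingAtEventHorizon M a Λ (-s) ω m R' ∧ IsOutgoingAtCosmoHorizon M a Λ ω m R' ∧
      ((∀ r ∈ Ioo (rPlus M a Λ) (rCosmo M a Λ), R' r = 0) →
        ∀ j : ℕ, j + 1 ≤ N → (s : ℂ) + 2 * horizonB M a Λ ω m (rCosmo M a Λ) = (j : ℂ) →
          ∃ r : Polynomial ℂ, r.natDegree + j + 1 ≤ N ∧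
            ∀ x ∈ Ioo (0 : ℝ) 1,
              R (mobiusInv M a Λ x) / heunWeight M a Λ s ω m (mobiusInv M a Λ x) =
                (x : ℂ) ^ (1 - heunGamma M a Λ s ω m) *
                  ((mobiusZr M a Λ - x : ℝ) : ℂ) ^ (1 - heunEps M a Λ s ω m) * r.eval (x : ℂ)) := by
  -- Hatsuda data of spin `s` and `−s`
  set zr := mobiusZr M a Λ with hzrdef
  have hzr : 1 < zr := one_lt_mobiusZr hsub
  set γ := heunGamma M a Λ s ω m with hγ
  set δ := heunDelta M a Λ s ω m with hδ
  set ε := heunEps M a Λ s ω m with hε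
  set σp := heunSigmaPlus s with hσp
  set σm := heunSigmaMinus M a Λ s ω m with hσm
  set q := heunV M a Λ s ω m lam with hq
  set γ' := heunGamma M a Λ (-s) ω m with hγ'
  set δ' := heunDelta M a Λ (-s) ω m with hδ'
  set ε' := heunEps M a Λ (-s) ω m with hε'
  set σp' := heunSigmaPlus (-s) with hσp'
  set σm' := heunSigmaMinus M a Λ (-s) ω m with hσm'
  set q' := heunV M a Λ (-s) ω m (lamFlip a Λ s lam) with hq'
  set ρ := mobiusInv M a Λ with hρ
  set w := heunWeight M a Λ s ω m with hw
  -- the Hatsuda-gauge function of `R` and its flip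
  set y : ℝ → ℂ := fun x => R (ρ x) / w (ρ x) with hy
  set ytil : ℝ → ℂ := fun x => flipWeight zr γ δ ε x * y x with hytil
  set u : ℝ → ℂ := deriv^[N] ytil with hu
  set ym : ℝ → ℂ := fun x => flipWeight zr (2 - γ') (2 - δ') (2 - ε') x * u x with hym
  set R' : ℝ → ℂ := fun r => heunWeight M a Λ (-s) ω m r * ym (mobiusZ M a Λ r) with hR'
  -- (1) equations
  have hysol : IsSolutionOn (zr : ℂ) σp σm γ δ ε q (Ioo 0 1) y :=
    heunSolution_of_isRadialTeukolskySolution hsub hR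
  have hF : γ + δ + ε = σp + σm + 1 := heun_fuchs hsub s ω m
  have hytilsol : IsSolutionOn (zr : ℂ) (2 - σp) (2 - σm) (2 - γ) (2 - δ) (2 - ε)
      (flipQ zr γ δ ε q) (Ioo 0 1) ytil :=
    isSolutionOn_flip hzr hF Subset.rfl hysol
  have hlead : ∀ x ∈ Ioo (0 : ℝ) 1, lead (zr : ℂ) x ≠ 0 := by
    intro x hx
    unfold lead
    have h0 : (x : ℂ) ≠ 0 := by exact_mod_cast hx.1.ne'
    have h1 : (x : ℂ) - 1 ≠ 0 := by
      have : ((x - 1 : ℝ) : ℂ) ≠ 0 := by exact_mod_cast (show x - 1 ≠ 0 by linarith [hx.2])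
      simpa using this
    have ha : (x : ℂ) - zr ≠ 0 := by
      have : ((x - zr : ℝ) : ℂ) ≠ 0 := by exact_mod_cast (show x - zr ≠ 0 by linarith [hx.2])
      simpa using this
    exact mul_ne_zero (mul_ne_zero h0 h1) ha
  have hytil_smooth : ContDiffOn ℝ ((⊤ : ℕ∞) : WithTop ℕ∞) ytil (Ioo 0 1) :=
    contDiffOn_of_isSolutionOn isOpen_Ioo hlead hytilsol
  have hα : 2 - σp = 1 - (N : ℂ) := two_sub_sigmaPlus s hsN
  have hF' : (2 - γ) + (2 - δ) + (2 - ε) = (2 - σp) + (2 - σm) + 1 := fuchs_flip hF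
  have husol₀ := isSolutionOn_iterate_deriv hF' hN1 hα isOpen_Ioo hytil_smooth hytilsol
  have husol : IsSolutionOn (zr : ℂ) (2 - σp') (2 - σm') (2 - γ') (2 - δ') (2 - ε')
      (flipQ zr γ' δ' ε' q') (Ioo 0 1) u := by
    have e1 : (N : ℂ) + 1 = 2 - σp' := image_sigmaPlus s hsN
    have e2 : 2 - σm + N = 2 - σm' := image_sigmaMinus M a Λ s ω m hsN
    have e3 : 2 - γ + N = 2 - γ' := image_gamma M a Λ s ω m hsN
    have e4 : 2 - δ + N = 2 - δ' := image_delta M a Λ s ω m hsN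
    have e5 : 2 - ε + N = 2 - ε' := image_eps M a Λ s ω m hsN
    have e6 := accessory_identity hsub s ω m lam hsN
    rw [e1, e2, e3, e4, e5, e6] at husol₀
    exact husol₀
  have hF'' : (2 - γ') + (2 - δ') + (2 - ε') = (2 - σp') + (2 - σm') + 1 :=
    fuchs_flip (heun_fuchs hsub (-s) ω m)
  have hymsol : IsSolutionOn (zr : ℂ) σp' σm' γ' δ' ε' q' (Ioo 0 1) ym := by
    have h := isSolutionOn_flip hzr hF'' Subset.rfl husol
    simp only [sub_sub_cancel, flipQ_flipQ] at h
    exact h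
  have hR'sol : IsRadialTeukolskySolution M a Λ (-s) ω m (lamFlip a Λ s lam) R' :=
    isRadialTeukolskySolution_of_heunSolution hsub hymsol
  -- (2) boundary shape at `x = 0` (event horizon): `ytil` is smooth across `0`
  obtain ⟨e₀, he₀, G, hG, hyG⟩ := heunSolution_branch_at_zero hsub hin
  set e := min e₀ 1 with hedef
  have he : 0 < e := lt_min he₀ one_pos
  have he1 : e ≤ 1 := min_le_right _ _
  have hee₀ : e ≤ e₀ := min_le_left _ _
  set F : ℝ → ℂ := fun x => ((1 - x : ℝ) : ℂ) ^ (δ - 1) * ((zr - x : ℝ) : ℂ) ^ (ε - 1) * G x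
    with hFdef
  have hFs : ContDiffOn ℝ ((⊤ : ℕ∞) : WithTop ℕ∞) F (Ioo (-e) e) := by
    have hG' : ContDiffOn ℝ ((⊤ : ℕ∞) : WithTop ℕ∞) G (Ioo (-e) e) :=
      hG.mono (Ioo_subset_Ioo (by linarith) hee₀)
    refine (ContDiffOn.mul ?_ ?_).mul hG'
    · exact contDiffOn_cpow_comp ((contDiff_const.sub contDiff_id).contDiffOn)
        (fun x hx => by have := hx.1; have := hx.2; (try simp only [id]); linarith) _
    · exact contDiffOn_cpow_comp ((contDiff_const.sub contDiff_id).contDiffOn)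
        (fun x hx => by have := hx.1; have := hx.2; (try simp only [id]); linarith) _
  have hagree0 : ∀ x ∈ Ioo 0 e, ytil x = F x := by
    intro x hx
    have hx0 : (0 : ℝ) < x := hx.1
    have hxG := hyG x ⟨hx0, lt_of_lt_of_le hx.2 hee₀⟩
    simp only [hytil, hFdef, flipWeight]
    rw [show y x = (x : ℂ) ^ (1 - γ) * G x from hxG]
    have hc : (x : ℂ) ^ (γ - 1) * (x : ℂ) ^ (1 - γ) = 1 := by
      rw [cpow_mul_cpow_ofReal hx0, show γ - 1 + (1 - γ) = 0 by ring, Complex.cpow_zero]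
    linear_combination ((1 - x : ℝ) : ℂ) ^ (δ - 1) * ((zr - x : ℝ) : ℂ) ^ (ε - 1) * G x * hc
  obtain ⟨hDF, huF⟩ := iterate_deriv_of_agree hFs hagree0 N
  have h0m : IsHeunBranchAtZero M a Λ (-s) ω m ym := by
    refine ⟨e, he, fun x => ((1 - x : ℝ) : ℂ) ^ (1 - δ') * ((zr - x : ℝ) : ℂ) ^ (1 - ε') *
      (deriv^[N] F) x, ?_, fun x hx => ?_⟩
    · refine (ContDiffOn.mul ?_ ?_).mul hDF
      · exact contDiffOn_cpow_comp ((contDiff_const.sub contDiff_id).contDiffOn)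
          (fun x hx => by have := hx.1; have := hx.2; (try simp only [id]); linarith) _
      · exact contDiffOn_cpow_comp ((contDiff_const.sub contDiff_id).contDiffOn)
          (fun x hx => by have := hx.1; have := hx.2; (try simp only [id]); linarith) _
    · simp only [hym, flipWeight]
      rw [show u x = (deriv^[N] F) x from huF x hx]
      rw [show (2 : ℂ) - γ' - 1 = 1 - heunGamma M a Λ (-s) ω m by rw [hγ']; ring,
        show (2 : ℂ) - δ' - 1 = 1 - δ' by ring, show (2 : ℂ) - ε' - 1 = 1 - ε' by ring]
      ring
  -- (3) boundary shape at `x = 1` (cosmological horizon): `ytil = (1−x)^{δ−1}·G₁`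
  obtain ⟨e₁, he₁, Fs, hFs1, hyF⟩ := heunSolution_smooth_at_one hsub s hout
  set d := min e₁ (min 1 (zr - 1)) with hddef
  have hd : 0 < d := lt_min he₁ (lt_min one_pos (by linarith))
  have hd1 : d ≤ 1 := (min_le_right _ _).trans (min_le_left _ _)
  have hdz : d ≤ zr - 1 := (min_le_right _ _).trans (min_le_right _ _)
  have hde₁ : d ≤ e₁ := min_le_left _ _
  set G₁ : ℝ → ℂ := fun x => (x : ℂ) ^ (γ - 1) * ((zr - x : ℝ) : ℂ) ^ (ε - 1) * Fs x with hG₁def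
  have hG₁ : ContDiffOn ℝ ((⊤ : ℕ∞) : WithTop ℕ∞) G₁ (Ioo (1 - d) (1 + d)) := by
    have hFs' : ContDiffOn ℝ ((⊤ : ℕ∞) : WithTop ℕ∞) Fs (Ioo (1 - d) (1 + d)) :=
      hFs1.mono (Ioo_subset_Ioo (by linarith) (by linarith))
    refine (ContDiffOn.mul ?_ ?_).mul hFs'
    · have := contDiffOn_cpow_comp (g := fun x : ℝ => x) (U := Ioo (1 - d) (1 + d))
        contDiff_id.contDiffOn (fun x hx => by have := hx.1; have := hx.2; linarith) (γ - 1)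
      simpa using this
    · exact contDiffOn_cpow_comp ((contDiff_const.sub contDiff_id).contDiffOn)
        (fun x hx => by have := hx.1; have := hx.2; (try simp only [id]); linarith) _
  have hbranch1 : ∀ x ∈ Ioo (1 - d) 1, ytil x = ((1 - x : ℝ) : ℂ) ^ (δ - 1) * G₁ x := by
    intro x hx
    have hxF := hyF x ⟨by linarith [hx.1], hx.2⟩
    simp only [hytil, hG₁def, flipWeight]
    rw [show y x = Fs x from hxF]
    ring
  have hH := iterate_deriv_of_branch hG₁ hbranch1 N
  have hHs : ContDiffOn ℝ ((⊤ : ℕ∞) : WithTop ℕ∞) (branchCoeff (δ - 1) G₁ N) (Ioo (1 - d) (1 + d)) :=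
    branchCoeff_smooth (δ - 1) isOpen_Ioo hG₁ N
  have h1m : IsHeunRegularAtOne ym := by
    refine ⟨d, hd, fun x => (x : ℂ) ^ (1 - γ') * ((zr - x : ℝ) : ℂ) ^ (1 - ε') *
      branchCoeff (δ - 1) G₁ N x, ?_, fun x hx => ?_⟩
    · refine (ContDiffOn.mul ?_ ?_).mul hHs
      · have := contDiffOn_cpow_comp (g := fun x : ℝ => x) (U := Ioo (1 - d) (1 + d))
          contDiff_id.contDiffOn (fun x hx => by have := hx.1; have := hx.2; linarith) (1 - γ')
        simpa using this
      · exact contDiffOn_cpow_comp ((contDiff_const.sub contDiff_id).contDiffOn)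
          (fun x hx => by have := hx.1; have := hx.2; (try simp only [id]); linarith) _
    · have hx1 : (0 : ℝ) < 1 - x := by linarith [hx.2]
      simp only [hym, flipWeight]
      rw [show u x = (deriv^[N] ytil) x from rfl, hH x hx]
      have hexp : ((1 - x : ℝ) : ℂ) ^ ((2 : ℂ) - δ' - 1) * ((1 - x : ℝ) : ℂ) ^ (δ - 1 - (N : ℕ)) = 1 := by
        rw [cpow_mul_cpow_ofReal hx1]
        have : (2 : ℂ) - δ' - 1 + (δ - 1 - (N : ℕ)) = 0 := by
          have := delta_sub_delta M a Λ s ω m hsN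
          rw [← hδ, ← hδ'] at this
          linear_combination this
        rw [this, Complex.cpow_zero]
      rw [show (2 : ℂ) - γ' - 1 = 1 - γ' by ring, show (2 : ℂ) - ε' - 1 = 1 - ε' by ring]
      linear_combination (x : ℂ) ^ (1 - γ') * ((zr - x : ℝ) : ℂ) ^ (1 - ε') *
        branchCoeff (δ - 1) G₁ N x * hexp
  have hin' : IsIngoingAtEventHorizon M a Λ (-s) ω m R' :=
    isIngoingAtEventHorizon_of_heun_branch_at_zero hsub (-s) ω m h0m
  have hout' : IsOutgoingAtCosmoHorizon M a Λ ω m R' :=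
    isOutgoingAtCosmoHorizon_of_heun_smooth_at_one hsub (-s) ω m h1m
  refine ⟨R', hR'sol, hin', hout', fun hR'0 => ?_⟩
  -- (4) consequences of `R' ≡ 0`
  have hz1 := one_lt_mobiusZinf hsub
  have hym0 : ∀ x ∈ Ioo (0 : ℝ) 1, ym x = 0 := by
    intro x hx
    have hxinf : x ≠ mobiusZinf M a Λ := ne_of_lt (hx.2.trans hz1)
    have hρx : ρ x ∈ Ioo (rPlus M a Λ) (rCosmo M a Λ) := mobiusInv_mem_Ioo hsub hx
    have h := hR'0 (ρ x) hρx
    simp only [hR'] at h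
    rw [hρ, mobiusZ_mobiusInv hsub hxinf] at h
    exact (mul_eq_zero.mp h).resolve_left (heunWeight_ne_zero hsub (-s) ω m hρx)
  have hu0 : ∀ x ∈ Ioo (0 : ℝ) 1, u x = 0 := fun x hx =>
    (flip_eq_zero_iff hzr (2 - γ') (2 - δ') (2 - ε') hx).mp (hym0 x hx)
  -- `ytil ≡ 0 ⇒ R ≡ 0`
  have hR_of_ytil : (∀ x ∈ Ioo (0 : ℝ) 1, ytil x = 0) →
      ∀ r ∈ Ioo (rPlus M a Λ) (rCosmo M a Λ), R r = 0 := by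
    intro hytil0 r hr
    have hx : mobiusZ M a Λ r ∈ Ioo (0 : ℝ) 1 := mobiusZ_mem_Ioo hsub hr
    have hy0 : y (mobiusZ M a Λ r) = 0 := (flip_eq_zero_iff hzr γ δ ε hx).mp (hytil0 _ hx)
    have hrm : r ≠ rMinus M a Λ := by
      obtain ⟨-, -, h01, -⟩ := hsub
      intro h; rw [h] at hr; exact absurd hr.1 (not_lt.mpr h01.le)
    simp only [hy, hρ, mobiusInv_mobiusZ hsub hrm] at hy0
    exact (div_eq_zero_iff.mp hy0).resolve_right (heunWeight_ne_zero hsub s ω m hr)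

  -- (4c) the polynomial kernel at the lattice point `δ − 1 = j`
  intro j hjN hlat
  have hμ : δ - 1 = (j : ℂ) := by rw [hδ, delta_sub_one]; exact hlat
  obtain ⟨P, hPdeg, hP⟩ := exists_polynomial_of_iterate_deriv_eq_zero zero_lt_one N hytil_smooth hu0
  -- recovering `y` from `ytil = (1−x)^j · r(x)`
  have hy_of : ∀ rr : Polynomial ℂ,
      (∀ x ∈ Ioo (0 : ℝ) 1, ytil x = ((1 - x : ℝ) : ℂ) ^ j * rr.eval (x : ℂ)) →
      ∀ x ∈ Ioo (0 : ℝ) 1,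
        y x = (x : ℂ) ^ (1 - γ) * ((zr - x : ℝ) : ℂ) ^ (1 - ε) * rr.eval (x : ℂ) := by
    intro rr hrr x hx
    have hx0 : (0 : ℝ) < x := hx.1
    have hx1 : (0 : ℝ) < 1 - x := by linarith [hx.2]
    have hxz : (0 : ℝ) < zr - x := by linarith [hx.2]
    have h := hrr x hx
    simp only [hytil, flipWeight] at h
    rw [hμ, Complex.cpow_natCast] at h
    have hne1 : ((1 - x : ℝ) : ℂ) ^ j ≠ 0 := pow_ne_zero _ (by exact_mod_cast hx1.ne')
    have hc0 : (x : ℂ) ^ (1 - γ) * (x : ℂ) ^ (γ - 1) = 1 := by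
      rw [cpow_mul_cpow_ofReal hx0, show (1 - γ) + (γ - 1) = 0 by ring, Complex.cpow_zero]
    have hcz : ((zr - x : ℝ) : ℂ) ^ (1 - ε) * ((zr - x : ℝ) : ℂ) ^ (ε - 1) = 1 := by
      rw [cpow_mul_cpow_ofReal hxz, show (1 - ε) + (ε - 1) = 0 by ring, Complex.cpow_zero]
    have h2 : ((1 - x : ℝ) : ℂ) ^ j *
        (y x - (x : ℂ) ^ (1 - γ) * ((zr - x : ℝ) : ℂ) ^ (1 - ε) * rr.eval (x : ℂ)) = 0 := by
      linear_combination ((x : ℂ) ^ (1 - γ) * ((zr - x : ℝ) : ℂ) ^ (1 - ε)) * h -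
        ((1 - x : ℝ) : ℂ) ^ j * y x * (((zr - x : ℝ) : ℂ) ^ (1 - ε) * ((zr - x : ℝ) : ℂ) ^ (ε - 1)) * hc0 -
        ((1 - x : ℝ) : ℂ) ^ j * y x * hcz
    exact sub_eq_zero.mp ((mul_eq_zero.mp h2).resolve_left hne1)
  by_cases hP0 : P = 0
  · refine ⟨0, by simp only [natDegree_zero]; omega, hy_of 0 fun x hx => ?_⟩
    rw [hP x hx, hP0]
    simp
  obtain ⟨qq, hPq, hqdvd⟩ := exists_eq_pow_rootMultiplicity_mul_and_not_dvd P hP0 1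
  set n := P.rootMultiplicity 1 with hn
  have hqq1 : qq.eval 1 ≠ 0 := fun h0 => hqdvd (dvd_iff_isRoot.mpr h0)
  have hqq0 : qq ≠ 0 := by rintro rfl; simp at hqq1
  have hPnat : P.natDegree < N := (natDegree_lt_iff_degree_lt hP0).mpr hPdeg
  have hdeg : P.natDegree = n + qq.natDegree := by
    have h := congrArg natDegree hPq
    rwa [natDegree_mul (pow_ne_zero _ (X_sub_C_ne_zero 1)) hqq0, natDegree_pow, natDegree_X_sub_C,
      mul_one] at h
  -- the outgoing branch forces `n − j ∈ ℕ`
  set Q : ℝ → ℂ := fun x => (-1) ^ n * qq.eval (x : ℂ) with hQdef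
  have hQs : ContDiffOn ℝ ((⊤ : ℕ∞) : WithTop ℕ∞) Q (Ioo (1 - d) (1 + d)) := by
    have h1 : ContDiff ℝ ((⊤ : ℕ∞) : WithTop ℕ∞) (fun x : ℝ => qq.eval (x : ℂ)) := by
      have hq0' : ContDiff ℂ ((⊤ : ℕ∞) : WithTop ℕ∞) (fun x : ℂ => aeval x qq) :=
        Polynomial.contDiff_aeval qq _
      have hq' := hq0'.restrict_scalars ℝ
      have e1 : (fun x : ℂ => aeval x qq) = fun x : ℂ => qq.eval x := by
        funext x; simp [coe_aeval_eq_eval]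
      rw [e1] at hq'
      exact hq'.comp Complex.ofRealCLM.contDiff
    exact (contDiff_const.mul h1).contDiffOn
  have hQ1 : Q 1 ≠ 0 := by
    simp only [hQdef, Complex.ofReal_one]
    exact mul_ne_zero (pow_ne_zero _ (by norm_num)) hqq1
  have hagree : ∀ x ∈ Ioo (1 - d) 1, ((1 - x : ℝ) : ℂ) ^ ((n : ℂ) - (j : ℂ)) * Q x = G₁ x := by
    intro x hx
    have hx01 : x ∈ Ioo (0 : ℝ) 1 := ⟨by linarith [hx.1], hx.2⟩
    have hpos : (0 : ℝ) < 1 - x := by linarith [hx.2]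
    have hne : ((1 - x : ℝ) : ℂ) ≠ 0 := by exact_mod_cast hpos.ne'
    have h1 := hbranch1 x hx
    rw [hP x hx01, hPq, eval_mul, eval_pow, eval_sub, eval_X, eval_C, hμ] at h1
    have hG' : G₁ x = ((1 - x : ℝ) : ℂ) ^ (-(j : ℂ)) * (((x : ℂ) - 1) ^ n * qq.eval (x : ℂ)) := by
      rw [h1, ← mul_assoc, ← Complex.cpow_add _ _ hne, neg_add_cancel, Complex.cpow_zero, one_mul]
    rw [hG', hQdef, Complex.cpow_sub _ _ hne, Complex.cpow_natCast, Complex.cpow_neg,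
      Complex.cpow_natCast]
    have e2 : ((x : ℂ) - 1) = -((1 - x : ℝ) : ℂ) := by push_cast; ring
    rw [e2, neg_pow]
    field_simp
    ring
  obtain ⟨n', hn'⟩ := natural_of_smooth_branch hd hQs hQ1 hG₁ hagree
  have hnj : n = j + n' := by
    have e : ((n : ℂ) - (j : ℂ)) = (((n : ℤ) - (j : ℤ) : ℤ) : ℂ) := by push_cast; ring
    rw [e] at hn'
    have h' : (n : ℤ) - j = n' := by exact_mod_cast hn'
    omega
  refine ⟨Polynomial.C ((-1 : ℂ) ^ j) * (X - Polynomial.C 1) ^ n' * qq, ?_, hy_of _ fun x hx => ?_⟩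
  · have h1 : (Polynomial.C ((-1 : ℂ) ^ j) * (X - Polynomial.C 1) ^ n' * qq).natDegree ≤
        n' + qq.natDegree := by
      calc _ ≤ (Polynomial.C ((-1 : ℂ) ^ j) * (X - Polynomial.C 1) ^ n').natDegree + qq.natDegree :=
            natDegree_mul_le
        _ ≤ ((X - Polynomial.C (1 : ℂ)) ^ n').natDegree + qq.natDegree := by
            gcongr; exact natDegree_C_mul_le _ _
        _ ≤ n' * (X - Polynomial.C (1 : ℂ)).natDegree + qq.natDegree := by
            gcongr; exact natDegree_pow_le
        _ = n' + qq.natDegree := by rw [natDegree_X_sub_C, mul_one]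
    omega
  · rw [hP x hx, hPq, hnj]
    simp only [eval_mul, eval_pow, eval_sub, eval_X, eval_C]
    have e2 : ((x : ℂ) - 1) = -((1 - x : ℝ) : ℂ) := by push_cast; ring
    rw [e2, pow_add, neg_pow, neg_pow]
    ring

end RouteW

end Literature.Geometry.Lorentzian.KerrDeSitter.TeukolskyRadial

end Part3

/-!
## Part 4 — port of `Summits/Ventures/KdS/SpinFlipIntertwine.lean` (17 declarations kept)

# Venture KdS — analysis toolkit for the Teukolsky–Starobinsky transfer (IV): the termwise Euler
# intertwining of Frobenius expansions at `w = 1` (pure algebra)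

HONEST FRAMING (venture `Summits/Ventures/KdS`, cell `pub-kds`; LIT-1 g22 under lead ruling A86):
general-Heun ALGEBRA in Umetsu's normalisation (`GeneralHeun.lead/mid/low`, accessory sign `+q`),
no analysis and nothing about Kerr–de Sitter. It is the algebraic core of the treatment of the
NON-EXTREME strata of the cosmological lattice (`s ≥ 5/2`, `Re ω = mϖ₂`, `0 < Im ω ≤ (s−2)κ₂`),
where the kernel of the Teukolsky–Starobinsky map contains polynomials of positive degree and the
explicit monomial partner of `RouteWSpinFlipLattice.lean` must be replaced by a general-degree one.

Contents. Writing `t = w − 1`, Umetsu's operator `M = lead ∂² + mid ∂ + low` (singular points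
`0, 1, a_H`) acts on monomials by
`M[t^μ] = t^{μ−1}·(X₀(μ) + X₁(μ)·t + X₂(μ)·t²)` with
`X₀(μ) = (1−a_H)μ(μ−1+δ)`, `X₁(μ) = (2−a_H)μ(μ−1) + [γ(1−a_H)+δ(2−a_H)+ε]μ + αβ + q`,
`X₂(μ) = μ(μ−1) + (γ+δ+ε)μ + αβ` (`symX₀/₁/₂`; the analytic statement is in
`SpinFlipFrobenius.lean`), so that `M[t^ρ Σ_k c_k t^k] = t^{ρ−1} Σ_n recCoeff_n t^n` with the
three-term recurrence `recCoeff`. For Takemura's parameter map of Euler's integral transformation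
with exponent `η`, `(η−α)(η−β) = 0` (`GeneralHeun.eulerSrc*`, landed), the image symbol satisfies,
for EVERY `μ` (Fuchs relation assumed),
`X̃₀(μ+η−1)·μ = X₀(μ)·(μ+η−1)`, `X̃₁(μ+η−1) = X₁(μ)`, `X̃₂(μ+η−1)·(μ+η) = X₂(μ)·(μ+1)`
(`symX₀_image`, `symX₁_image`, `symX₂_image`). Consequently the **partner coefficients**
`b_k = c_k · ∏_{i<k}(ρ+1+i) · ∏_{k≤i≤D}(ρ+η+i)` (`partnerCoeff`, for `c` supported in `k ≤ D`)
satisfy `recCoeff(image, ρ+η−1, b)_{n+1} = W_n · recCoeff(source, ρ, c)_{n+1}` (`recCoeff_partner_succ`)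
and `recCoeff(image, ρ+η−1, b)_0 = 0` when `ρ = 1−δ` (`recCoeff_partner_zero`): a formal solution
`t^ρ·(polynomial)` of the source equation yields the formal solution `t^{ρ+η−1}·(polynomial)` of the
image equation (`recCoeff_partner_eq_zero`) — the termwise (Beta-function) action of Euler's
transformation on Frobenius series, valid without any convergence condition on `Re ρ`. The weights
do not vanish off the resonances `ρ+1+i = 0`, `ρ+η+i = 0` (`partnerWeight_ne_zero`). 0 cited facts.

References: K. Takemura, *Integral transformation of Heun's equation and some applications*,
J. Math. Soc. Japan 69 (2017) 849–891 [Takemura2017], Proposition 1.2 (parameter map, as vendored in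
`Literature/Analysis/ODE/HeunEulerKernel.lean`); H. Umetsu, Prog. Theor. Phys. 104 (2000) 743
[Umetsu2000] §3 (normalisation).

(Verbatim declaration-level port — the declarations listed in the Part header count — of the Summits-side module of the KdS
venture; venture / cell / ruling bookkeeping in the text above is historical.)
-/

section Part4

open _root_.Finset

namespace Literature.Geometry.Lorentzian.KerrDeSitter.TeukolskyRadial

namespace SpinFlipTS

open Literature.Analysis.ODE Literature.Analysis.ODE.GeneralHeun

/-! ### The monomial symbol of Umetsu's operator at `t = w − 1` -/

/-- `X₀(μ) = (1 − a_H)·μ·(μ − 1 + δ)`: the coefficient of `t^{μ−1}` in `M[(w−1)^μ]`.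
[cite: CasalsTeixeiradacosta2022, Proposition 3.8 (arXiv v2) with Lemma 3.5 and the proof of Theorem 3.10, Step 2 (route W / spin-flip bookkeeping of the in-tree proof)] -/
def symX₀ (aH δ μ : ℂ) : ℂ := (1 - aH) * μ * (μ - 1 + δ)

/-- `X₁(μ) = (2 − a_H)μ(μ−1) + [γ(1−a_H) + δ(2−a_H) + ε]μ + αβ + q`: the coefficient of `t^{μ}`.
[cite: CasalsTeixeiradacosta2022, Proposition 3.8 (arXiv v2) with Lemma 3.5 and the proof of Theorem 3.10, Step 2 (route W / spin-flip bookkeeping of the in-tree proof)] -/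
def symX₁ (aH α β γ δ ε q μ : ℂ) : ℂ :=
  (2 - aH) * μ * (μ - 1) + (γ * (1 - aH) + δ * (2 - aH) + ε) * μ + α * β + q

/-- `X₂(μ) = μ(μ−1) + (γ+δ+ε)μ + αβ` (the coefficient of `t^{μ+1}`; `= (μ+α)(μ+β)` under the Fuchs
relation, `symX₂_eq_mul`).
[cite: CasalsTeixeiradacosta2022, Proposition 3.8 (arXiv v2) with Lemma 3.5 and the proof of Theorem 3.10, Step 2 (route W / spin-flip bookkeeping of the in-tree proof)] -/
def symX₂ (α β γ δ ε μ : ℂ) : ℂ := μ * (μ - 1) + (γ + δ + ε) * μ + α * β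

/-- Under the Fuchs relation `X₂(μ) = (μ+α)(μ+β)` (the indicial polynomial at infinity).
[cite: CasalsTeixeiradacosta2022, Proposition 3.8 (arXiv v2) with Lemma 3.5 and the proof of Theorem 3.10, Step 2 (route W / spin-flip bookkeeping of the in-tree proof)] -/
theorem symX₂_eq_mul {α β γ δ ε : ℂ} (hF : γ + δ + ε = α + β + 1) (μ : ℂ) :
    symX₂ α β γ δ ε μ = (μ + α) * (μ + β) := by
  unfold symX₂; linear_combination μ * hF

/-- **Recurrence coefficients.** For a coefficient sequence `c` and an exponent `μ`,
`M[Σ_k c_k t^{μ+k}] = t^{μ−1}·Σ_n recCoeff_n t^n` with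
`recCoeff_n = c_n X₀(μ+n) + c_{n−1} X₁(μ+n−1) + c_{n−2} X₂(μ+n−2)` (absent terms omitted for
`n = 0, 1`).
[cite: CasalsTeixeiradacosta2022, Proposition 3.8 (arXiv v2) with Lemma 3.5 and the proof of Theorem 3.10, Step 2 (route W / spin-flip bookkeeping of the in-tree proof)] -/
def recCoeff (aH α β γ δ ε q μ : ℂ) (c : ℕ → ℂ) : ℕ → ℂ
  | 0 => c 0 * symX₀ aH δ μ
  | 1 => c 1 * symX₀ aH δ (μ + 1) + c 0 * symX₁ aH α β γ δ ε q μ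
  | n + 2 => c (n + 2) * symX₀ aH δ (μ + (n + 2)) +
      c (n + 1) * symX₁ aH α β γ δ ε q (μ + (n + 1)) + c n * symX₂ α β γ δ ε (μ + n)

/-- Beyond the support of `c` the recurrence coefficients vanish.
[cite: CasalsTeixeiradacosta2022, Proposition 3.8 (arXiv v2) with Lemma 3.5 and the proof of Theorem 3.10, Step 2 (route W / spin-flip bookkeeping of the in-tree proof)] -/
theorem recCoeff_eq_zero_of_le {aH α β γ δ ε q μ : ℂ} {c : ℕ → ℂ} {K : ℕ}
    (hc : ∀ k, K ≤ k → c k = 0) {n : ℕ} (hn : K + 2 ≤ n) :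
    recCoeff aH α β γ δ ε q μ c n = 0 := by
  obtain ⟨m, rfl⟩ : ∃ m, n = m + 2 := ⟨n - 2, by omega⟩
  simp only [recCoeff]
  rw [hc (m + 2) (by omega), hc (m + 1) (by omega), hc m (by omega)]
  ring

/-! ### The partner weights -/

/-- **Partner weights** `W_k = ∏_{i<k}(ρ+1+i) · ∏_{k≤i≤D}(ρ+η+i)` (the termwise action of Euler's
transformation with exponent `η` on `t^{ρ+k}`, cleared of denominators over `0 ≤ k ≤ D`).
[cite: CasalsTeixeiradacosta2022, Proposition 3.8 (arXiv v2) with Lemma 3.5 and the proof of Theorem 3.10, Step 2 (route W / spin-flip bookkeeping of the in-tree proof)] -/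
def partnerWeight (ρ η : ℂ) (D k : ℕ) : ℂ :=
  (∏ i ∈ range k, (ρ + 1 + i)) * ∏ i ∈ Ico k (D + 1), (ρ + η + i)

/-- **Partner coefficients** `b_k = c_k · W_k`.
[cite: CasalsTeixeiradacosta2022, Proposition 3.8 (arXiv v2) with Lemma 3.5 and the proof of Theorem 3.10, Step 2 (route W / spin-flip bookkeeping of the in-tree proof)] -/
def partnerCoeff (ρ η : ℂ) (D : ℕ) (c : ℕ → ℂ) (k : ℕ) : ℂ := c k * partnerWeight ρ η D k

/-- The ratio rule `W_{k+1}·(ρ+η+k) = W_k·(ρ+1+k)` for `k ≤ D`.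
[cite: CasalsTeixeiradacosta2022, Proposition 3.8 (arXiv v2) with Lemma 3.5 and the proof of Theorem 3.10, Step 2 (route W / spin-flip bookkeeping of the in-tree proof)] -/
theorem partnerWeight_succ (ρ η : ℂ) {D k : ℕ} (hk : k ≤ D) :
    partnerWeight ρ η D (k + 1) * (ρ + η + k) = partnerWeight ρ η D k * (ρ + 1 + k) := by
  unfold partnerWeight
  rw [prod_range_succ, prod_eq_prod_Ico_succ_bot (Nat.lt_succ_of_le hk)]
  ring

/-- Off the resonances `ρ+1+i = 0`, `ρ+η+i = 0` (`i ∈ ℕ`) no weight vanishes.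
[cite: CasalsTeixeiradacosta2022, Proposition 3.8 (arXiv v2) with Lemma 3.5 and the proof of Theorem 3.10, Step 2 (route W / spin-flip bookkeeping of the in-tree proof)] -/
theorem partnerWeight_ne_zero {ρ η : ℂ} (h1 : ∀ i : ℕ, ρ + 1 + i ≠ 0)
    (h2 : ∀ i : ℕ, ρ + η + i ≠ 0) (D k : ℕ) : partnerWeight ρ η D k ≠ 0 := by
  unfold partnerWeight
  exact mul_ne_zero (prod_ne_zero_iff.mpr fun i _ => h1 i) (prod_ne_zero_iff.mpr fun i _ => h2 i)

/-- The partner coefficients are supported where `c` is.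
[cite: CasalsTeixeiradacosta2022, Proposition 3.8 (arXiv v2) with Lemma 3.5 and the proof of Theorem 3.10, Step 2 (route W / spin-flip bookkeeping of the in-tree proof)] -/
theorem partnerCoeff_eq_zero {ρ η : ℂ} {D : ℕ} {c : ℕ → ℂ} {k : ℕ} (hk : c k = 0) :
    partnerCoeff ρ η D c k = 0 := by
  unfold partnerCoeff; rw [hk, zero_mul]

/-- Off the resonances, `b_k = 0` forces `c_k = 0`.
[cite: CasalsTeixeiradacosta2022, Proposition 3.8 (arXiv v2) with Lemma 3.5 and the proof of Theorem 3.10, Step 2 (route W / spin-flip bookkeeping of the in-tree proof)] -/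
theorem eq_zero_of_partnerCoeff_eq_zero {ρ η : ℂ} (h1 : ∀ i : ℕ, ρ + 1 + i ≠ 0)
    (h2 : ∀ i : ℕ, ρ + η + i ≠ 0) {D : ℕ} {c : ℕ → ℂ} {k : ℕ}
    (hk : partnerCoeff ρ η D c k = 0) : c k = 0 :=
  (mul_eq_zero.mp hk).resolve_right (partnerWeight_ne_zero h1 h2 D k)

/-! ### Takemura's image symbol -/

/-- `X̃₁(μ+η−1) = X₁(μ) − (η−α)(η−β)` (Fuchs relation).
[cite: CasalsTeixeiradacosta2022, Proposition 3.8 (arXiv v2) with Lemma 3.5 and the proof of Theorem 3.10, Step 2 (route W / spin-flip bookkeeping of the in-tree proof)] -/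
theorem symX₁_image {α β γ δ ε : ℂ} (aH q η μ : ℂ) (hF : γ + δ + ε = α + β + 1) :
    symX₁ aH (eulerSrcα η) (eulerSrcβ α β η) (eulerSrc γ η) (eulerSrc δ η) (eulerSrc ε η)
        (eulerSrcQ aH γ δ ε q η) (μ + η - 1) =
      symX₁ aH α β γ δ ε q μ - (η - α) * (η - β) := by
  unfold symX₁ eulerSrcα eulerSrcβ eulerSrc eulerSrcQ
  linear_combination (2 * (η - 1)) * hF

/-- `X̃₂(μ+η−1) = (μ+1)(μ+α+β−η)` (Fuchs relation), hence, when `(η−α)(η−β) = 0`,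
`X̃₂(μ+η−1)·(μ+η) = X₂(μ)·(μ+1)`.
[cite: CasalsTeixeiradacosta2022, Proposition 3.8 (arXiv v2) with Lemma 3.5 and the proof of Theorem 3.10, Step 2 (route W / spin-flip bookkeeping of the in-tree proof)] -/
theorem symX₂_image {α β γ δ ε : ℂ} (η μ : ℂ) (hF : γ + δ + ε = α + β + 1) :
    symX₂ (eulerSrcα η) (eulerSrcβ α β η) (eulerSrc γ η) (eulerSrc δ η) (eulerSrc ε η)
        (μ + η - 1) = (μ + 1) * (μ + α + β - η) := by
  unfold symX₂ eulerSrcα eulerSrcβ eulerSrc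
  linear_combination (μ + η - 1) * hF

/-! ### The intertwining of the recurrences -/

section Intertwine

variable {aH α β γ δ ε q η ρ : ℂ} {D : ℕ} {c : ℕ → ℂ}

/-- At `n = 0` both recurrence coefficients vanish when `ρ = 1 − δ` is the local exponent
(`X₀(ρ) = 0 = X̃₀(ρ+η−1)`).
[cite: CasalsTeixeiradacosta2022, Proposition 3.8 (arXiv v2) with Lemma 3.5 and the proof of Theorem 3.10, Step 2 (route W / spin-flip bookkeeping of the in-tree proof)] -/
theorem recCoeff_partner_zero (hρ : ρ = 1 - δ) :
    recCoeff aH (eulerSrcα η) (eulerSrcβ α β η) (eulerSrc γ η) (eulerSrc δ η) (eulerSrc ε η)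
        (eulerSrcQ aH γ δ ε q η) (ρ + η - 1) (partnerCoeff ρ η D c) 0 = 0 := by
  simp only [recCoeff]
  unfold symX₀ eulerSrc
  rw [hρ]; ring

/-- **Termwise intertwining.** For `c` supported in `k ≤ D`, the Fuchs relation and
`(η−α)(η−β) = 0`: `recCoeff(image, ρ+η−1, b)_{n+1} = W_n · recCoeff(source, ρ, c)_{n+1}` for every
`n` (no condition on `ρ`).
[cite: CasalsTeixeiradacosta2022, Proposition 3.8 (arXiv v2) with Lemma 3.5 and the proof of Theorem 3.10, Step 2 (route W / spin-flip bookkeeping of the in-tree proof)] -/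
theorem recCoeff_partner_succ (hF : γ + δ + ε = α + β + 1) (hroot : (η - α) * (η - β) = 0)
    (hc : ∀ k, D < k → c k = 0) (n : ℕ) :
    recCoeff aH (eulerSrcα η) (eulerSrcβ α β η) (eulerSrc γ η) (eulerSrc δ η) (eulerSrc ε η)
        (eulerSrcQ aH γ δ ε q η) (ρ + η - 1) (partnerCoeff ρ η D c) (n + 1) =
      partnerWeight ρ η D n * recCoeff aH α β γ δ ε q ρ c (n + 1) := by
  -- the `X₀`-terms: `b_{k+1} X̃₀(ρ+η+k) = W_k c_{k+1} X₀(ρ+k+1)` for every `k`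
  have hT0 : ∀ k : ℕ, partnerCoeff ρ η D c (k + 1) * symX₀ aH (eulerSrc δ η) (ρ + η - 1 + (k + 1)) =
      partnerWeight ρ η D k * (c (k + 1) * symX₀ aH δ (ρ + (k + 1))) := by
    intro k
    have e1 : symX₀ aH (eulerSrc δ η) (ρ + η - 1 + (k + 1)) =
        (1 - aH) * (ρ + η + k) * (ρ + k + δ) := by
      unfold symX₀ eulerSrc; ring
    have e2 : symX₀ aH δ (ρ + (k + 1)) = (1 - aH) * (ρ + 1 + k) * (ρ + k + δ) := by
      unfold symX₀; ring
    rw [e1, e2]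
    unfold partnerCoeff
    by_cases hk : k ≤ D
    · have hW := partnerWeight_succ ρ η hk
      linear_combination c (k + 1) * (1 - aH) * (ρ + ↑k + δ) * hW
    · rw [hc (k + 1) (by omega)]; ring
  -- the `X₁`-terms: `b_k X̃₁(ρ+η−1+k) = W_k c_k X₁(ρ+k)` for every `k`
  have hT1 : ∀ k : ℕ, partnerCoeff ρ η D c k *
      symX₁ aH (eulerSrcα η) (eulerSrcβ α β η) (eulerSrc γ η) (eulerSrc δ η) (eulerSrc ε η)
        (eulerSrcQ aH γ δ ε q η) (ρ + η - 1 + k) =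
      partnerWeight ρ η D k * (c k * symX₁ aH α β γ δ ε q (ρ + k)) := by
    intro k
    have e1 := symX₁_image aH q η (ρ + k) hF
    rw [show ρ + η - 1 + (k : ℂ) = ρ + k + η - 1 by ring, e1, hroot, sub_zero]
    unfold partnerCoeff; ring
  -- the `X₂`-terms: `b_k X̃₂(ρ+η−1+k) = W_{k+1} c_k X₂(ρ+k)` for every `k`
  have hT2 : ∀ k : ℕ, partnerCoeff ρ η D c k *
      symX₂ (eulerSrcα η) (eulerSrcβ α β η) (eulerSrc γ η) (eulerSrc δ η) (eulerSrc ε η)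
        (ρ + η - 1 + k) =
      partnerWeight ρ η D (k + 1) * (c k * symX₂ α β γ δ ε (ρ + k)) := by
    intro k
    have e1 := symX₂_image η (ρ + k) hF
    rw [show ρ + η - 1 + (k : ℂ) = ρ + k + η - 1 by ring, e1, symX₂_eq_mul hF]
    unfold partnerCoeff
    by_cases hk : k ≤ D
    · have hW := partnerWeight_succ ρ η hk
      linear_combination -(c k * (ρ + ↑k + α + β - η)) * hW -
        c k * partnerWeight ρ η D (k + 1) * hroot
    · rw [hc k (by omega)]; ring
  cases n with
  | zero =>
    simp only [recCoeff]
    have h0 := hT0 0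
    have h1 := hT1 0
    push_cast at h0 h1 ⊢
    simp only [add_zero, zero_add] at h0 h1 ⊢
    linear_combination h0 + h1
  | succ m =>
    simp only [recCoeff]
    have h0 := hT0 (m + 1)
    have h1 := hT1 (m + 1)
    have h2 := hT2 m
    push_cast at h0 h1 h2 ⊢
    have e3 : ρ + η - 1 + ((m : ℂ) + 1 + 1) = ρ + η - 1 + ((m : ℂ) + 2) := by ring
    have e4 : ρ + ((m : ℂ) + 1 + 1) = ρ + ((m : ℂ) + 2) := by ring
    rw [e3, e4] at h0
    linear_combination h0 + h1 + h2

/-- **A formal solution yields a formal partner solution.** If all source recurrence coefficients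
vanish (so `t^ρ Σ c_k t^k` is annihilated by `M` termwise) and `ρ = 1−δ`, then all image recurrence
coefficients of the partner vanish.
[cite: CasalsTeixeiradacosta2022, Proposition 3.8 (arXiv v2) with Lemma 3.5 and the proof of Theorem 3.10, Step 2 (route W / spin-flip bookkeeping of the in-tree proof)] -/
theorem recCoeff_partner_eq_zero (hF : γ + δ + ε = α + β + 1) (hroot : (η - α) * (η - β) = 0)
    (hρ : ρ = 1 - δ) (hc : ∀ k, D < k → c k = 0)
    (hsrc : ∀ n, recCoeff aH α β γ δ ε q ρ c n = 0) (n : ℕ) :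
    recCoeff aH (eulerSrcα η) (eulerSrcβ α β η) (eulerSrc γ η) (eulerSrc δ η) (eulerSrc ε η)
        (eulerSrcQ aH γ δ ε q η) (ρ + η - 1) (partnerCoeff ρ η D c) n = 0 := by
  cases n with
  | zero => exact recCoeff_partner_zero hρ
  | succ m => rw [recCoeff_partner_succ hF hroot hc m, hsrc (m + 1), mul_zero]

end Intertwine

end SpinFlipTS

end Literature.Geometry.Lorentzian.KerrDeSitter.TeukolskyRadial

end Part4

/-!
## Part 5 — port of `Summits/Ventures/KdS/SpinFlipFrobenius.lean` (19 declarations kept)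

# Venture KdS — analysis toolkit for the Teukolsky–Starobinsky transfer (V): Frobenius-polynomial
# solutions `Σ_k c_k (w−1)^{μ+k}` of Heun's equation on `(1, b)` and their formal Euler partner

HONEST FRAMING (venture `Summits/Ventures/KdS`, cell `pub-kds`; LIT-1 g22 under lead ruling A86):
general-Heun ANALYSIS in Umetsu's normalisation (`GeneralHeun.IsSolutionOn`), nothing about
Kerr–de Sitter. For a finitely supported coefficient sequence `c` and an exponent `μ` consider
`F(w) = Σ_{k<K} c_k (w−1)^{μ+k}` on `w > 1` (principal powers of the positive real `w − 1`;
`cpowSum`). This file proves: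

* `heunOp_cpowSum`: with the closed forms `cpowSum₁`, `cpowSum₂` of `F′`, `F″`
  (`hasDerivAt_cpowSum`, `hasDerivAt_cpowSum₁`),
  `lead·F″ + mid·F′ + low·F = (w−1)^{μ−1} · symbolSum(w−1)` where
  `symbolSum(t) = Σ_k c_k t^k (X₀(μ+k) + X₁(μ+k)t + X₂(μ+k)t²)` is built from the monomial symbol of
  `SpinFlipIntertwine.lean`;
* `symbolSum_eq_sum_recCoeff`: `symbolSum(t) = Σ_n recCoeff_n t^n` (the three-term recurrence);
* `isSolutionOn_cpowSum` / `symbolSum_eq_zero_of_isSolutionOn`: `F` solves Heun's equation on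
  `(1, b)` iff the symbol vanishes there, iff (`recCoeff_eq_zero_of_isSolutionOn`) every recurrence
  coefficient vanishes (a polynomial with infinitely many roots is zero);
* `isSolutionOn_partner`: **the formal Euler transform of a Frobenius-polynomial solution is a
  solution** — if `Σ_{k≤D} c_k (w−1)^{ρ+k}` solves `Hn(a_H; α,β; γ,δ,ε; q)` on some `(1,b)`, `b > 1`,
  with `ρ = 1−δ`, the Fuchs relation and `(η−α)(η−β) = 0`, then
  `Σ_{k≤D} b_k (w−1)^{ρ+η−1+k}` (partner coefficients of `SpinFlipIntertwine`) solves Takemura's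
  image equation on every `(1, b′)` — no condition on `Re ρ` (where the Euler integral itself would
  diverge);
* `coeff_eq_zero_of_cpowSum_eq_zero`: `F ≡ 0` on `(1,b)` forces `c_k = 0` (`k < K`).

0 cited facts, no `sorry`.

(Verbatim declaration-level port — the declarations listed in the Part header count — of the Summits-side module of the KdS
venture; venture / cell / ruling bookkeeping in the text above is historical.)
-/

section Part5

open _root_.Set _root_.Complex _root_.Filter _root_.Topology _root_.Finset _root_.Polynomial

namespace Literature.Geometry.Lorentzian.KerrDeSitter.TeukolskyRadial

namespace SpinFlipTS

open Literature.Analysis.ODE Literature.Analysis.ODE.GeneralHeun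

/-! ### Powers of `w − 1` -/

/-- `d/dw (w − 1)^p = (w − 1)^p · p/(w − 1)` for `w > 1` (principal power of a positive real).
[cite: CasalsTeixeiradacosta2022, Proposition 3.8 (arXiv v2) with Lemma 3.5 and the proof of Theorem 3.10, Step 2 (route W / spin-flip bookkeeping of the in-tree proof)] -/
private theorem hasDerivAt_sub_one_cpow (p : ℂ) {r : ℝ} (hr : 1 < r) :
    HasDerivAt (fun x : ℝ => ((x - 1 : ℝ) : ℂ) ^ p)
      (((r - 1 : ℝ) : ℂ) ^ p * (p / ((r : ℂ) - 1))) r := by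
  have hpos : (0 : ℝ) < r - 1 := sub_pos.2 hr
  have hslit : ((r : ℂ) - 1) ∈ slitPlane := by
    have : ((r - 1 : ℝ) : ℂ) ∈ slitPlane := Complex.ofReal_mem_slitPlane.2 hpos
    simpa using this
  have hne : ((r : ℂ) - 1) ≠ 0 := by
    have : ((r - 1 : ℝ) : ℂ) ≠ 0 := by exact_mod_cast hpos.ne'
    simpa using this
  have h1 : HasDerivAt (fun z : ℂ => (z - 1) ^ p) (p * ((r : ℂ) - 1) ^ (p - 1) * 1) (r : ℂ) :=
    ((hasDerivAt_id (r : ℂ)).sub_const (1 : ℂ)).cpow_const hslit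
  have hfun : (fun x : ℝ => ((x - 1 : ℝ) : ℂ) ^ p) = fun y : ℝ => ((y : ℂ) - 1) ^ p := by
    funext y; push_cast; ring_nf
  rw [hfun]
  refine h1.comp_ofReal.congr_deriv ?_
  rw [mul_one, Complex.cpow_sub _ _ hne, Complex.cpow_one]
  push_cast
  field_simp

/-- A positive real base has non-vanishing principal powers.
[cite: CasalsTeixeiradacosta2022, Proposition 3.8 (arXiv v2) with Lemma 3.5 and the proof of Theorem 3.10, Step 2 (route W / spin-flip bookkeeping of the in-tree proof)] -/
private theorem sub_one_cpow_ne_zero (p : ℂ) {w : ℝ} (hw : 1 < w) : ((w - 1 : ℝ) : ℂ) ^ p ≠ 0 :=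
  fun h => absurd (Complex.cpow_eq_zero_iff _ _ |>.mp h).1 (by exact_mod_cast (sub_pos.2 hw).ne')

/-! ### The Frobenius sums and their derivatives -/

/-- `F(w) = Σ_{k<K} c_k (w−1)^{μ+k}`.
[cite: CasalsTeixeiradacosta2022, Proposition 3.8 (arXiv v2) with Lemma 3.5 and the proof of Theorem 3.10, Step 2 (route W / spin-flip bookkeeping of the in-tree proof)] -/
def cpowSum (μ : ℂ) (c : ℕ → ℂ) (K : ℕ) (w : ℝ) : ℂ :=
  ∑ k ∈ range K, c k * ((w - 1 : ℝ) : ℂ) ^ (μ + k)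

/-- Closed form of `F′` on `w > 1`.
[cite: CasalsTeixeiradacosta2022, Proposition 3.8 (arXiv v2) with Lemma 3.5 and the proof of Theorem 3.10, Step 2 (route W / spin-flip bookkeeping of the in-tree proof)] -/
def cpowSum₁ (μ : ℂ) (c : ℕ → ℂ) (K : ℕ) (w : ℝ) : ℂ :=
  ∑ k ∈ range K, c k * (((w - 1 : ℝ) : ℂ) ^ (μ + k) * ((μ + k) / ((w : ℂ) - 1)))

/-- Closed form of `F″` on `w > 1`.
[cite: CasalsTeixeiradacosta2022, Proposition 3.8 (arXiv v2) with Lemma 3.5 and the proof of Theorem 3.10, Step 2 (route W / spin-flip bookkeeping of the in-tree proof)] -/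
def cpowSum₂ (μ : ℂ) (c : ℕ → ℂ) (K : ℕ) (w : ℝ) : ℂ :=
  ∑ k ∈ range K, c k *
    (((w - 1 : ℝ) : ℂ) ^ (μ + k) * ((μ + k) * (μ + k - 1) / ((w : ℂ) - 1) ^ 2))

/-- `F′ = cpowSum₁` on `w > 1`.
[cite: CasalsTeixeiradacosta2022, Proposition 3.8 (arXiv v2) with Lemma 3.5 and the proof of Theorem 3.10, Step 2 (route W / spin-flip bookkeeping of the in-tree proof)] -/
theorem hasDerivAt_cpowSum (μ : ℂ) (c : ℕ → ℂ) (K : ℕ) {w : ℝ} (hw : 1 < w) :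
    HasDerivAt (cpowSum μ c K) (cpowSum₁ μ c K w) w := by
  unfold cpowSum cpowSum₁
  exact HasDerivAt.fun_sum fun k _ => (hasDerivAt_sub_one_cpow (μ + k) hw).const_mul (c k)

/-- `F″ = cpowSum₂` on `w > 1`.
[cite: CasalsTeixeiradacosta2022, Proposition 3.8 (arXiv v2) with Lemma 3.5 and the proof of Theorem 3.10, Step 2 (route W / spin-flip bookkeeping of the in-tree proof)] -/
theorem hasDerivAt_cpowSum₁ (μ : ℂ) (c : ℕ → ℂ) (K : ℕ) {w : ℝ} (hw : 1 < w) :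
    HasDerivAt (cpowSum₁ μ c K) (cpowSum₂ μ c K w) w := by
  have hne : ((w : ℂ) - 1) ≠ 0 := by
    have : ((w - 1 : ℝ) : ℂ) ≠ 0 := by exact_mod_cast (show w - 1 ≠ 0 by linarith)
    simpa using this
  have hc : HasDerivAt (fun t : ℝ => (t : ℂ)) 1 w := by simpa using (hasDerivAt_id w).ofReal_comp
  unfold cpowSum₁ cpowSum₂
  refine HasDerivAt.fun_sum fun k _ => ?_
  have hD := hasDerivAt_sub_one_cpow (μ + k) hw
  have hinv : HasDerivAt (fun t : ℝ => (μ + k) / ((t : ℂ) - 1))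
      (-((μ + k) * 1) / ((w : ℂ) - 1) ^ 2) w := by
    have := ((hc.sub_const (1 : ℂ)).inv hne).const_mul (μ + k)
    refine (this.congr_deriv (by field_simp)).congr_of_eventuallyEq ?_
    exact Filter.Eventually.of_forall fun t => by simp [div_eq_mul_inv]
  refine ((hD.mul hinv).const_mul (c k)).congr_deriv ?_
  push_cast
  field_simp
  ring

/-- Each term, hence `F`, is smooth on `w > 1`.
[cite: CasalsTeixeiradacosta2022, Proposition 3.8 (arXiv v2) with Lemma 3.5 and the proof of Theorem 3.10, Step 2 (route W / spin-flip bookkeeping of the in-tree proof)] -/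
theorem contDiffOn_cpowSum (μ : ℂ) (c : ℕ → ℂ) (K : ℕ) :
    ContDiffOn ℝ ((⊤ : ℕ∞) : WithTop ℕ∞) (cpowSum μ c K) (Ioi 1) := by
  have hterm : ∀ p : ℂ, ContDiffOn ℝ ((⊤ : ℕ∞) : WithTop ℕ∞)
      (fun w : ℝ => ((w - 1 : ℝ) : ℂ) ^ p) (Ioi 1) := by
    intro p x hx
    have hx' : (0 : ℝ) < x - 1 := sub_pos.2 hx
    have hslit : ((x - 1 : ℝ) : ℂ) ∈ slitPlane := Complex.ofReal_mem_slitPlane.2 hx'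
    have h1 : AnalyticAt ℂ (fun z : ℂ => z ^ p) ((x - 1 : ℝ) : ℂ) :=
      analyticAt_id.cpow analyticAt_const hslit
    have h3 : AnalyticAt ℝ (fun y : ℝ => ((y - 1 : ℝ) : ℂ)) x := by
      have : AnalyticAt ℝ (fun y : ℝ => (y : ℂ) - 1) x :=
        (Complex.ofRealCLM.analyticAt x).sub analyticAt_const
      refine this.congr (Filter.Eventually.of_forall fun y => ?_)
      push_cast; ring
    have h4 : AnalyticAt ℝ (fun y : ℝ => ((y - 1 : ℝ) : ℂ) ^ p) x :=
      AnalyticAt.comp (g := fun z : ℂ => z ^ p) (f := fun y : ℝ => ((y - 1 : ℝ) : ℂ)) (x := x)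
        h1.restrictScalars h3
    exact h4.contDiffAt.contDiffWithinAt
  unfold cpowSum
  exact ContDiffOn.sum fun k _ => contDiffOn_const.mul (hterm (μ + k))

/-- Explicit form: `F(w) = (w−1)^μ · Σ_{k<K} c_k (w−1)^k` for `w > 1`.
[cite: CasalsTeixeiradacosta2022, Proposition 3.8 (arXiv v2) with Lemma 3.5 and the proof of Theorem 3.10, Step 2 (route W / spin-flip bookkeeping of the in-tree proof)] -/
theorem cpowSum_eq (μ : ℂ) (c : ℕ → ℂ) (K : ℕ) {w : ℝ} (hw : 1 < w) :
    cpowSum μ c K w = ((w - 1 : ℝ) : ℂ) ^ μ * ∑ k ∈ range K, c k * ((w : ℂ) - 1) ^ k := by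
  have hne : ((w - 1 : ℝ) : ℂ) ≠ 0 := by exact_mod_cast (show w - 1 ≠ 0 by linarith)
  unfold cpowSum
  rw [mul_sum]
  refine sum_congr rfl fun k _ => ?_
  rw [Complex.cpow_add _ _ hne, Complex.cpow_natCast]
  push_cast
  ring

/-! ### The symbol -/

/-- `symbolSum(t) = Σ_{k<K} c_k t^k (X₀(μ+k) + X₁(μ+k)·t + X₂(μ+k)·t²)`.
[cite: CasalsTeixeiradacosta2022, Proposition 3.8 (arXiv v2) with Lemma 3.5 and the proof of Theorem 3.10, Step 2 (route W / spin-flip bookkeeping of the in-tree proof)] -/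
def symbolSum (aH α β γ δ ε q μ : ℂ) (c : ℕ → ℂ) (K : ℕ) (t : ℂ) : ℂ :=
  ∑ k ∈ range K, c k * t ^ k *
    (symX₀ aH δ (μ + k) + symX₁ aH α β γ δ ε q (μ + k) * t + symX₂ α β γ δ ε (μ + k) * t ^ 2)

/-- **The operator on a Frobenius sum.** For `w > 1`:
`lead·F″ + mid·F′ + low·F = (w−1)^{μ−1}·symbolSum(w−1)`.
[cite: CasalsTeixeiradacosta2022, Proposition 3.8 (arXiv v2) with Lemma 3.5 and the proof of Theorem 3.10, Step 2 (route W / spin-flip bookkeeping of the in-tree proof)] -/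
theorem heunOp_cpowSum (aH α β γ δ ε q μ : ℂ) (c : ℕ → ℂ) (K : ℕ) {w : ℝ} (hw : 1 < w) :
    lead aH w * cpowSum₂ μ c K w + mid aH γ δ ε w * cpowSum₁ μ c K w +
        low α β q w * cpowSum μ c K w =
      ((w - 1 : ℝ) : ℂ) ^ (μ - 1) * symbolSum aH α β γ δ ε q μ c K ((w : ℂ) - 1) := by
  have hne' : ((w - 1 : ℝ) : ℂ) ≠ 0 := by exact_mod_cast (show w - 1 ≠ 0 by linarith)
  have hne : ((w : ℂ) - 1) ≠ 0 := by simpa using hne'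
  unfold cpowSum cpowSum₁ cpowSum₂ symbolSum
  rw [mul_sum, mul_sum, mul_sum, mul_sum, ← sum_add_distrib, ← sum_add_distrib]
  refine sum_congr rfl fun k _ => ?_
  have hsplit : ((w - 1 : ℝ) : ℂ) ^ (μ + k) =
      ((w - 1 : ℝ) : ℂ) ^ (μ - 1) * (((w : ℂ) - 1) ^ k * ((w : ℂ) - 1)) := by
    rw [show μ + (k : ℂ) = (μ - 1) + ((k + 1 : ℕ) : ℂ) by push_cast; ring,
      Complex.cpow_add _ _ hne', Complex.cpow_natCast, pow_succ]
    push_cast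
    ring
  rw [hsplit]
  unfold lead mid low symX₀ symX₁ symX₂
  push_cast
  field_simp
  ring

/-! ### Solutions versus the symbol -/

/-- If the symbol vanishes along `(1, b)` then `F` is a classical solution there.
[cite: CasalsTeixeiradacosta2022, Proposition 3.8 (arXiv v2) with Lemma 3.5 and the proof of Theorem 3.10, Step 2 (route W / spin-flip bookkeeping of the in-tree proof)] -/
theorem isSolutionOn_cpowSum {aH α β γ δ ε q μ : ℂ} {c : ℕ → ℂ} {K : ℕ} {b : ℝ}
    (hsym : ∀ w ∈ Ioo 1 b, symbolSum aH α β γ δ ε q μ c K ((w : ℂ) - 1) = 0) :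
    IsSolutionOn aH α β γ δ ε q (Ioo 1 b) (cpowSum μ c K) := by
  refine ⟨cpowSum₁ μ c K, cpowSum₂ μ c K, fun w hw =>
    ⟨hasDerivAt_cpowSum μ c K hw.1, hasDerivAt_cpowSum₁ μ c K hw.1, ?_⟩⟩
  rw [heunOp_cpowSum aH α β γ δ ε q μ c K hw.1, hsym w hw, mul_zero]

/-- Conversely, along an interval of solution the symbol vanishes.
[cite: CasalsTeixeiradacosta2022, Proposition 3.8 (arXiv v2) with Lemma 3.5 and the proof of Theorem 3.10, Step 2 (route W / spin-flip bookkeeping of the in-tree proof)] -/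
theorem symbolSum_eq_zero_of_isSolutionOn {aH α β γ δ ε q μ : ℂ} {c : ℕ → ℂ} {K : ℕ} {b : ℝ}
    (hsol : IsSolutionOn aH α β γ δ ε q (Ioo 1 b) (cpowSum μ c K)) :
    ∀ w ∈ Ioo 1 b, symbolSum aH α β γ δ ε q μ c K ((w : ℂ) - 1) = 0 := by
  obtain ⟨f₁, f₂, h⟩ := hsol
  intro w hw
  obtain ⟨h1, h2, h3⟩ := h w hw
  have e1 : f₁ w = cpowSum₁ μ c K w := h1.unique (hasDerivAt_cpowSum μ c K hw.1)
  have hev : f₁ =ᶠ[𝓝 w] cpowSum₁ μ c K := by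
    filter_upwards [isOpen_Ioo.mem_nhds hw] with t ht using
      (h t ht).1.unique (hasDerivAt_cpowSum μ c K ht.1)
  have e2 : f₂ w = cpowSum₂ μ c K w :=
    (h2.congr_of_eventuallyEq hev.symm).unique (hasDerivAt_cpowSum₁ μ c K hw.1)
  rw [e1, e2, heunOp_cpowSum aH α β γ δ ε q μ c K hw.1] at h3
  exact (mul_eq_zero.mp h3).resolve_left (sub_one_cpow_ne_zero _ hw.1)

/-! ### The symbol versus the recurrence -/

/-- **Regrouping by powers.** For `c` supported in `k < K`:
`symbolSum(t) = Σ_{n<K+2} recCoeff_n t^n`.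
[cite: CasalsTeixeiradacosta2022, Proposition 3.8 (arXiv v2) with Lemma 3.5 and the proof of Theorem 3.10, Step 2 (route W / spin-flip bookkeeping of the in-tree proof)] -/
theorem symbolSum_eq_sum_recCoeff {aH α β γ δ ε q μ : ℂ} {c : ℕ → ℂ} {K : ℕ}
    (hc : ∀ k, K ≤ k → c k = 0) (t : ℂ) :
    symbolSum aH α β γ δ ε q μ c K t =
      ∑ n ∈ range (K + 2), recCoeff aH α β γ δ ε q μ c n * t ^ n := by
  -- the three families of terms
  set g₀ : ℕ → ℂ := fun k => c k * symX₀ aH δ (μ + k) * t ^ k with hg₀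
  set g₁ : ℕ → ℂ := fun k => c k * symX₁ aH α β γ δ ε q (μ + k) * t ^ (k + 1) with hg₁
  set g₂ : ℕ → ℂ := fun k => c k * symX₂ α β γ δ ε (μ + k) * t ^ (k + 2) with hg₂
  have hS : symbolSum aH α β γ δ ε q μ c K t =
      ∑ k ∈ range K, g₀ k + ∑ k ∈ range K, g₁ k + ∑ k ∈ range K, g₂ k := by
    unfold symbolSum
    rw [← sum_add_distrib, ← sum_add_distrib]
    exact sum_congr rfl fun k _ => by simp only [hg₀, hg₁, hg₂]; ring
  -- vanishing tails
  have hz₀ : g₀ K = 0 := by simp only [hg₀]; rw [hc K le_rfl]; ring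
  have hz₀' : g₀ (K + 1) = 0 := by simp only [hg₀]; rw [hc (K + 1) (by omega)]; ring
  have hz₁ : g₁ K = 0 := by simp only [hg₁]; rw [hc K le_rfl]; ring
  -- re-indexing the two shifted families
  have hA : ∑ k ∈ range K, g₀ k = ∑ k ∈ range K, g₀ (k + 2) + g₀ 1 + g₀ 0 := by
    have h := (sum_range_succ g₀ K)
    have h' := (sum_range_succ g₀ (K + 1))
    have h'' : ∑ k ∈ range (K + 2), g₀ k = ∑ k ∈ range K, g₀ (k + 1 + 1) + g₀ (0 + 1) + g₀ 0 := by
      rw [sum_range_succ', sum_range_succ']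
    simp only [zero_add] at h''
    rw [hz₀] at h
    rw [hz₀'] at h'
    rw [← h'', h', h]
    ring
  have hB : ∑ k ∈ range K, g₁ k = ∑ k ∈ range K, g₁ (k + 1) + g₁ 0 := by
    have h := sum_range_succ g₁ K
    have h'' : ∑ k ∈ range (K + 1), g₁ k = ∑ k ∈ range K, g₁ (k + 1) + g₁ 0 := sum_range_succ' g₁ K
    rw [hz₁] at h
    rw [← h'', h, add_zero]
  -- the right-hand side, peeled twice
  have hR : ∑ n ∈ range (K + 2), recCoeff aH α β γ δ ε q μ c n * t ^ n =
      ∑ n ∈ range K, recCoeff aH α β γ δ ε q μ c (n + 2) * t ^ (n + 2) +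
        recCoeff aH α β γ δ ε q μ c 1 * t ^ 1 + recCoeff aH α β γ δ ε q μ c 0 * t ^ 0 := by
    rw [sum_range_succ', sum_range_succ']
  have hmain : ∑ n ∈ range K, recCoeff aH α β γ δ ε q μ c (n + 2) * t ^ (n + 2) =
      ∑ k ∈ range K, g₀ (k + 2) + ∑ k ∈ range K, g₁ (k + 1) + ∑ k ∈ range K, g₂ k := by
    rw [← sum_add_distrib, ← sum_add_distrib]
    refine sum_congr rfl fun n _ => ?_
    simp only [recCoeff, hg₀, hg₁, hg₂]
    push_cast
    ring
  have e0 : recCoeff aH α β γ δ ε q μ c 0 * t ^ 0 = g₀ 0 := by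
    simp only [recCoeff, hg₀]; push_cast; ring
  have e1 : recCoeff aH α β γ δ ε q μ c 1 * t ^ 1 = g₀ 1 + g₁ 0 := by
    simp only [recCoeff, hg₀, hg₁]; push_cast; ring
  rw [hS, hA, hB, hR, hmain, e0, e1]
  ring

/-- If every recurrence coefficient vanishes, the symbol vanishes identically.
[cite: CasalsTeixeiradacosta2022, Proposition 3.8 (arXiv v2) with Lemma 3.5 and the proof of Theorem 3.10, Step 2 (route W / spin-flip bookkeeping of the in-tree proof)] -/
theorem symbolSum_eq_zero_of_recCoeff {aH α β γ δ ε q μ : ℂ} {c : ℕ → ℂ} {K : ℕ}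
    (hc : ∀ k, K ≤ k → c k = 0) (hrec : ∀ n, recCoeff aH α β γ δ ε q μ c n = 0) (t : ℂ) :
    symbolSum aH α β γ δ ε q μ c K t = 0 := by
  rw [symbolSum_eq_sum_recCoeff hc]
  exact sum_eq_zero fun n _ => by rw [hrec n, zero_mul]

/-- Coefficients of a finite power sum vanishing on a real interval are zero.
[cite: CasalsTeixeiradacosta2022, Proposition 3.8 (arXiv v2) with Lemma 3.5 and the proof of Theorem 3.10, Step 2 (route W / spin-flip bookkeeping of the in-tree proof)] -/
theorem coeff_eq_zero_of_sum_eval_eq_zero {r : ℕ → ℂ} {K : ℕ} {a b : ℝ} (hab : a < b)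
    (h : ∀ s : ℝ, s ∈ Ioo a b → ∑ n ∈ range K, r n * (s : ℂ) ^ n = 0) :
    ∀ n, n < K → r n = 0 := by
  set P : Polynomial ℂ := ∑ n ∈ range K, C (r n) * X ^ n with hPdef
  have hP : ∀ s ∈ Ioo a b, P.eval (s : ℂ) = 0 := by
    intro s hs
    rw [← h s hs, hPdef, eval_finsetSum]
    simp only [eval_mul, eval_C, eval_pow, eval_X]
  have hP0 : P = 0 := by
    apply eq_zero_of_infinite_isRoot
    have hinf : (((↑) : ℝ → ℂ) '' Ioo a b).Infinite :=
      (Ioo_infinite hab).image Complex.ofReal_injective.injOn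
    refine hinf.mono ?_
    rintro _ ⟨x, hx, rfl⟩
    exact hP x hx
  intro n hn
  have hcoef := congrArg (fun Q : Polynomial ℂ => Q.coeff n) hP0
  simp only [hPdef, finsetSum_coeff, coeff_C_mul_X_pow, coeff_zero] at hcoef
  rw [sum_ite_eq (range K) n r, if_pos (mem_range.mpr hn)] at hcoef
  exact hcoef

/-- **A Frobenius-polynomial solution satisfies the recurrence.**
[cite: CasalsTeixeiradacosta2022, Proposition 3.8 (arXiv v2) with Lemma 3.5 and the proof of Theorem 3.10, Step 2 (route W / spin-flip bookkeeping of the in-tree proof)] -/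
theorem recCoeff_eq_zero_of_isSolutionOn {aH α β γ δ ε q μ : ℂ} {c : ℕ → ℂ} {K : ℕ} {b : ℝ}
    (hb : 1 < b) (hc : ∀ k, K ≤ k → c k = 0)
    (hsol : IsSolutionOn aH α β γ δ ε q (Ioo 1 b) (cpowSum μ c K)) :
    ∀ n, recCoeff aH α β γ δ ε q μ c n = 0 := by
  have hsym := symbolSum_eq_zero_of_isSolutionOn hsol
  have hpoly : ∀ s : ℝ, s ∈ Ioo 0 (b - 1) →
      ∑ n ∈ range (K + 2), recCoeff aH α β γ δ ε q μ c n * (s : ℂ) ^ n = 0 := by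
    intro s hs
    have hw : s + 1 ∈ Ioo 1 b := ⟨by linarith [hs.1], by linarith [hs.2]⟩
    have := hsym (s + 1) hw
    rw [symbolSum_eq_sum_recCoeff hc] at this
    push_cast at this
    simpa using this
  have hK := coeff_eq_zero_of_sum_eval_eq_zero (by linarith) hpoly
  intro n
  by_cases hn : n < K + 2
  · exact hK n hn
  · exact recCoeff_eq_zero_of_le hc (by omega)

/-- **`F ≡ 0` on `(1, b)` forces all coefficients to vanish.**
[cite: CasalsTeixeiradacosta2022, Proposition 3.8 (arXiv v2) with Lemma 3.5 and the proof of Theorem 3.10, Step 2 (route W / spin-flip bookkeeping of the in-tree proof)] -/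
theorem coeff_eq_zero_of_cpowSum_eq_zero {μ : ℂ} {c : ℕ → ℂ} {K : ℕ} {b : ℝ} (hb : 1 < b)
    (h : ∀ w ∈ Ioo 1 b, cpowSum μ c K w = 0) : ∀ k, k < K → c k = 0 := by
  refine coeff_eq_zero_of_sum_eval_eq_zero (a := 0) (b := b - 1) (by linarith) fun s hs => ?_
  have hw : (1 : ℝ) < s + 1 := by linarith [hs.1]
  have h0 := h (s + 1) ⟨hw, by linarith [hs.2]⟩
  rw [cpowSum_eq μ c K hw] at h0
  have h1 := (mul_eq_zero.mp h0).resolve_left (sub_one_cpow_ne_zero μ hw)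
  push_cast at h1
  simpa using h1

/-! ### The formal Euler partner is a solution -/

/-- **The formal Euler transform of a Frobenius-polynomial solution solves the image equation.**
If `Σ_{k≤D} c_k (w−1)^{ρ+k}` (coefficients supported in `k ≤ D`) solves `Hn(a_H; α,β; γ,δ,ε; q)`
on some `(1, b)`, `b > 1`, where `ρ = 1 − δ`, the Fuchs relation holds and `(η−α)(η−β) = 0`, then the
partner `Σ_{k≤D} b_k (w−1)^{ρ+η−1+k}` solves Takemura's image equation
`Hn(a_H; 2−η, α+β−2η+1; γ−η+1, δ−η+1, ε−η+1; q′)` on every `(1, b′)`.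
[cite: CasalsTeixeiradacosta2022, Proposition 3.8 (arXiv v2) with Lemma 3.5 and the proof of Theorem 3.10, Step 2 (route W / spin-flip bookkeeping of the in-tree proof)] -/
theorem isSolutionOn_partner {aH α β γ δ ε q η ρ : ℂ} {D : ℕ} {c : ℕ → ℂ} {b : ℝ} (hb : 1 < b)
    (hF : γ + δ + ε = α + β + 1) (hroot : (η - α) * (η - β) = 0) (hρ : ρ = 1 - δ)
    (hc : ∀ k, D < k → c k = 0)
    (hsol : IsSolutionOn aH α β γ δ ε q (Ioo 1 b) (cpowSum ρ c (D + 1))) (b' : ℝ) :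
    IsSolutionOn aH (eulerSrcα η) (eulerSrcβ α β η) (eulerSrc γ η) (eulerSrc δ η) (eulerSrc ε η)
      (eulerSrcQ aH γ δ ε q η) (Ioo 1 b') (cpowSum (ρ + η - 1) (partnerCoeff ρ η D c) (D + 1)) := by
  have hc' : ∀ k, D + 1 ≤ k → c k = 0 := fun k hk => hc k (by omega)
  have hsrc := recCoeff_eq_zero_of_isSolutionOn hb hc' hsol
  have himg := recCoeff_partner_eq_zero (aH := aH) (q := q) hF hroot hρ hc hsrc
  have hb' : ∀ k, D + 1 ≤ k → partnerCoeff ρ η D c k = 0 :=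
    fun k hk => partnerCoeff_eq_zero (hc k (by omega))
  exact isSolutionOn_cpowSum fun w _ => symbolSum_eq_zero_of_recCoeff hb' himg _

end SpinFlipTS

end Literature.Geometry.Lorentzian.KerrDeSitter.TeukolskyRadial

end Part5

/-!
## Part 6 — port of `Summits/Ventures/KdS/SpinFlipEulerForm.lean` (7 declarations kept)

# Venture KdS — analysis toolkit for the Teukolsky–Starobinsky transfer (VI): the Möbius image of
# `x^{1−γ}(z_r−x)^{1−ε}·r(x)` is a Frobenius-polynomial function; mode data of such functions

HONEST FRAMING (venture `Summits/Ventures/KdS`, cell `pub-kds`; LIT-1 g22 under lead ruling A86):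
general-Heun bookkeeping, nothing about Kerr–de Sitter. For a polynomial `r` with `deg r ≤ D` and
exponents with `γ + ε − 2 − σ = D`, the Möbius–Euler image `z^{−σ}·y(z_r(z−1)/z)`
(`GeneralHeun.mobiusV`) of `y(x) = x^{1−γ}(z_r−x)^{1−ε}·r(x)` is
`k_{γ+ε−2}(z_r)·(w−1)^{1−γ}·A(w−1)` with the explicit polynomial
`A(T) = Σ_{i≤D} r_i z_r^i T^i (T+1)^{D−i}` of degree `≤ D` (`shiftPoly`, `mobiusV_eq_cpow_mul_eval`),
i.e. a Frobenius-polynomial function `Σ_k a_k (w−1)^{ρ+k}` of `SpinFlipFrobenius`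
(`cpow_mul_eval_eq_cpowSum`); and a Frobenius-polynomial solution on `(1, z₂)` is Euler-gauge Heun
mode data in the sense of `RouteW.HeunModeData` (`heunModeData_cpowSum`: branch
`(w−1)^μ·(polynomial)` at `1`, smooth across `z₂`). Used by `RouteWSpinFlipStrata.lean`.
0 cited facts, no `sorry`.

(Verbatim declaration-level port — the declarations listed in the Part header count — of the Summits-side module of the KdS
venture; venture / cell / ruling bookkeeping in the text above is historical.)
-/

section Part6

open _root_.Set _root_.Complex _root_.Filter _root_.Topology _root_.Finset _root_.Polynomial

namespace Literature.Geometry.Lorentzian.KerrDeSitter.TeukolskyRadial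

namespace SpinFlipTS

open Literature.Analysis.ODE Literature.Analysis.ODE.GeneralHeun

/-! ### The Möbius image of `x^{1−γ}(z_r−x)^{1−ε}·r(x)` is a Frobenius-polynomial function -/

/-- The polynomial `A(T) = Σ_{i≤D} r_i z_r^i T^i (T+1)^{D−i}`:
`w^D · r(z_r(w−1)/w) = A(w−1)`.
[cite: CasalsTeixeiradacosta2022, Proposition 3.8 (arXiv v2) with Lemma 3.5 and the proof of Theorem 3.10, Step 2 (route W / spin-flip bookkeeping of the in-tree proof)] -/
def shiftPoly (zr : ℝ) (D : ℕ) (r : Polynomial ℂ) : Polynomial ℂ :=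
  ∑ i ∈ range (D + 1), C (r.coeff i * (zr : ℂ) ^ i) * X ^ i * (X + C 1) ^ (D - i)

/-- `deg A ≤ D`.
[cite: CasalsTeixeiradacosta2022, Proposition 3.8 (arXiv v2) with Lemma 3.5 and the proof of Theorem 3.10, Step 2 (route W / spin-flip bookkeeping of the in-tree proof)] -/
theorem shiftPoly_natDegree_le (zr : ℝ) (D : ℕ) (r : Polynomial ℂ) :
    (shiftPoly zr D r).natDegree ≤ D := by
  unfold shiftPoly
  refine natDegree_sum_le_of_forall_le _ _ fun i hi => ?_
  have hiD : i ≤ D := Nat.lt_succ_iff.mp (mem_range.mp hi)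
  calc (C (r.coeff i * (zr : ℂ) ^ i) * X ^ i * (X + C 1) ^ (D - i)).natDegree
      ≤ (C (r.coeff i * (zr : ℂ) ^ i) * X ^ i).natDegree + ((X + C (1 : ℂ)) ^ (D - i)).natDegree :=
        natDegree_mul_le
    _ ≤ i + (D - i) * (X + C (1 : ℂ)).natDegree := by
        gcongr
        · exact natDegree_C_mul_X_pow_le _ _
        · exact natDegree_pow_le
    _ = D := by rw [natDegree_X_add_C, mul_one]; omega

/-- `w^D · r(z_r(w−1)/w) = A(w−1)` for `w ≠ 0` when `deg r ≤ D`.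
[cite: CasalsTeixeiradacosta2022, Proposition 3.8 (arXiv v2) with Lemma 3.5 and the proof of Theorem 3.10, Step 2 (route W / spin-flip bookkeeping of the in-tree proof)] -/
theorem shiftPoly_eval {zr : ℝ} {D : ℕ} {r : Polynomial ℂ} (hr : r.natDegree ≤ D) {w : ℝ}
    (hw : w ≠ 0) :
    (w : ℂ) ^ D * r.eval ((mobiusX zr w : ℝ) : ℂ) = (shiftPoly zr D r).eval ((w : ℂ) - 1) := by
  have hw' : (w : ℂ) ≠ 0 := by exact_mod_cast hw
  have hx : ((mobiusX zr w : ℝ) : ℂ) = (zr : ℂ) * ((w : ℂ) - 1) / (w : ℂ) := by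
    unfold mobiusX; push_cast; ring
  rw [eval_eq_sum_range' (lt_of_le_of_lt hr (Nat.lt_succ_self D)), hx, mul_sum]
  unfold shiftPoly
  rw [eval_finsetSum]
  refine sum_congr rfl fun i hi => ?_
  obtain ⟨k, hk⟩ := Nat.exists_eq_add_of_le (Nat.lt_succ_iff.mp (mem_range.mp hi))
  rw [hk, Nat.add_sub_cancel_left]
  simp only [eval_mul, eval_C, eval_pow, eval_X, eval_add, sub_add_cancel]
  rw [div_pow, mul_pow, pow_add]
  field_simp

/-- `k_c(z_r/w) = k_c(z_r)·k_{−c}(w)` for positive reals.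
[cite: CasalsTeixeiradacosta2022, Proposition 3.8 (arXiv v2) with Lemma 3.5 and the proof of Theorem 3.10, Step 2 (route W / spin-flip bookkeeping of the in-tree proof)] -/
theorem eulerKernel_div (c : ℂ) {zr w : ℝ} (hzr : 0 < zr) (hw : 0 < w) :
    eulerKernel c (zr / w) = eulerKernel c zr * eulerKernel (-c) w := by
  unfold eulerKernel
  rw [Real.log_div hzr.ne' hw.ne', ← Complex.exp_add]
  push_cast
  ring_nf

/-- **Euler-gauge form.** If `y(x) = x^{1−γ}(z_r−x)^{1−ε}·r(x)` on `(0,1)` with `deg r ≤ D` and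
`γ + ε − 2 − σ = D`, then for `w > 1` with `z_r(w−1)/w ∈ (0,1)`:
`z^{−σ}y(z_r(w−1)/w) = k_{γ+ε−2}(z_r) · (w−1)^{1−γ} · A(w−1)`.
[cite: CasalsTeixeiradacosta2022, Proposition 3.8 (arXiv v2) with Lemma 3.5 and the proof of Theorem 3.10, Step 2 (route W / spin-flip bookkeeping of the in-tree proof)] -/
theorem mobiusV_eq_cpow_mul_eval {zr : ℝ} (hzr : 0 < zr) {σ γ ε : ℂ} {D : ℕ} {r : Polynomial ℂ}
    (hr : r.natDegree ≤ D) (hκ : γ + ε - 2 - σ = D) {y : ℝ → ℂ}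
    (hy : ∀ x ∈ Ioo (0 : ℝ) 1,
      y x = (x : ℂ) ^ (1 - γ) * ((zr - x : ℝ) : ℂ) ^ (1 - ε) * r.eval (x : ℂ))
    {w : ℝ} (hw : 1 < w) (hx : mobiusX zr w ∈ Ioo (0 : ℝ) 1) :
    mobiusV zr σ y w = eulerKernel (γ + ε - 2) zr *
      (((w - 1 : ℝ) : ℂ) ^ (1 - γ) * (shiftPoly zr D r).eval ((w : ℂ) - 1)) := by
  have hw0 : 0 < w := by linarith
  have hq : 0 < zr / w := div_pos hzr hw0
  have hxe : mobiusX zr w = (w - 1) * (zr / w) := by unfold mobiusX; field_simp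
  have hzx : zr - mobiusX zr w = zr / w := by unfold mobiusX; field_simp; ring
  have hq' : ((zr / w : ℝ) : ℂ) ≠ 0 := by exact_mod_cast hq.ne'
  have hxpow : ((mobiusX zr w : ℝ) : ℂ) ^ (1 - γ) =
      ((w - 1 : ℝ) : ℂ) ^ (1 - γ) * ((zr / w : ℝ) : ℂ) ^ (1 - γ) := by
    rw [hxe, Complex.ofReal_mul, Complex.mul_cpow_ofReal_nonneg (by linarith) hq.le]
  simp only [mobiusV]
  rw [hy _ hx, hzx, hxpow]
  -- collect the powers of `z_r/w`
  have h1 : ((zr / w : ℝ) : ℂ) ^ (1 - γ) * ((zr / w : ℝ) : ℂ) ^ (1 - ε) =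
      eulerKernel (γ + ε - 2) zr * eulerKernel (-(γ + ε - 2)) w := by
    rw [← Complex.cpow_add _ _ hq', ← eulerKernel_div _ hzr hw0, eulerKernel_eq_cpow _ hq]
    push_cast
    ring_nf
  have h2 : eulerKernel σ w * eulerKernel (-(γ + ε - 2)) w = (w : ℂ) ^ D := by
    rw [RouteW.eulerKernel_mul, show σ + -(γ + ε - 2) = -(D : ℂ) by linear_combination -hκ,
      RouteW.eulerKernel_neg_eq_cpow _ hw0, Complex.cpow_natCast]
  have h3 := shiftPoly_eval (zr := zr) hr hw0.ne'
  calc eulerKernel σ w * (((w - 1 : ℝ) : ℂ) ^ (1 - γ) * ((zr / w : ℝ) : ℂ) ^ (1 - γ) *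
        ((zr / w : ℝ) : ℂ) ^ (1 - ε) * r.eval ((mobiusX zr w : ℝ) : ℂ))
      = ((w - 1 : ℝ) : ℂ) ^ (1 - γ) *
          (((zr / w : ℝ) : ℂ) ^ (1 - γ) * ((zr / w : ℝ) : ℂ) ^ (1 - ε)) *
          (eulerKernel σ w * r.eval ((mobiusX zr w : ℝ) : ℂ)) := by ring
    _ = ((w - 1 : ℝ) : ℂ) ^ (1 - γ) * (eulerKernel (γ + ε - 2) zr) *
          ((eulerKernel σ w * eulerKernel (-(γ + ε - 2)) w) * r.eval ((mobiusX zr w : ℝ) : ℂ)) := by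
        rw [h1]; ring
    _ = eulerKernel (γ + ε - 2) zr *
          (((w - 1 : ℝ) : ℂ) ^ (1 - γ) * (shiftPoly zr D r).eval ((w : ℂ) - 1)) := by
        rw [h2, h3]; ring

/-- The Frobenius-polynomial function of a polynomial: for `w > 1`,
`c·(w−1)^ρ·A(w−1) = Σ_{k≤D} (c·A_k)(w−1)^{ρ+k}` when `deg A ≤ D`.
[cite: CasalsTeixeiradacosta2022, Proposition 3.8 (arXiv v2) with Lemma 3.5 and the proof of Theorem 3.10, Step 2 (route W / spin-flip bookkeeping of the in-tree proof)] -/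
theorem cpow_mul_eval_eq_cpowSum {A : Polynomial ℂ} {D : ℕ} (hA : A.natDegree ≤ D) (c ρ : ℂ)
    {w : ℝ} (hw : 1 < w) :
    c * (((w - 1 : ℝ) : ℂ) ^ ρ * A.eval ((w : ℂ) - 1)) =
      cpowSum ρ (fun k => c * A.coeff k) (D + 1) w := by
  rw [cpowSum_eq ρ _ (D + 1) hw, eval_eq_sum_range' (lt_of_le_of_lt hA (Nat.lt_succ_self D)),
    mul_sum, mul_sum, mul_sum]
  exact sum_congr rfl fun k _ => by ring

/-- Mode data of a Frobenius-polynomial solution on `(1, z₂)`: branch `(w−1)^μ·(polynomial)` at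
`1`, smooth across `z₂`.
[cite: CasalsTeixeiradacosta2022, Proposition 3.8 (arXiv v2) with Lemma 3.5 and the proof of Theorem 3.10, Step 2 (route W / spin-flip bookkeeping of the in-tree proof)] -/
theorem heunModeData_cpowSum {z₂ : ℝ} (hz₂ : 1 < z₂) {α β γ δ ε q μ : ℂ} {c : ℕ → ℂ} {K : ℕ}
    (hsol : IsSolutionOn (z₂ : ℂ) α β γ δ ε q (Ioo 1 z₂) (cpowSum μ c K)) :
    RouteW.HeunModeData z₂ α β γ δ ε q μ (cpowSum μ c K) := by
  have hpoly : ContDiff ℝ ((⊤ : ℕ∞) : WithTop ℕ∞)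
      (fun w : ℝ => ∑ k ∈ range K, c k * ((w : ℂ) - 1) ^ k) :=
    ContDiff.sum fun k _ => contDiff_const.mul
      ((Complex.ofRealCLM.contDiff.sub contDiff_const).pow k)
  have hsub : Ioo (z₂ - (z₂ - 1) / 2) (z₂ + (z₂ - 1) / 2) ⊆ Ioi 1 := fun w hw =>
    Set.mem_Ioi.mpr (by have := hw.1; linarith)
  exact ⟨hsol, ⟨1, one_pos, fun w => ∑ k ∈ range K, c k * ((w : ℂ) - 1) ^ k, hpoly.contDiffOn,
    fun w hw => cpowSum_eq μ c K hw.1⟩, ⟨(z₂ - 1) / 2, by linarith, cpowSum μ c K,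
    (contDiffOn_cpowSum μ c K).mono hsub, fun w _ => rfl⟩⟩

end SpinFlipTS

end Literature.Geometry.Lorentzian.KerrDeSitter.TeukolskyRadial

end Part6

/-!
## Part 7 — port of `Summits/Ventures/KdS/RouteWSpinFlipStrata.lean` (3 declarations kept)

# Venture KdS — the spin flip on the cosmological lattice (III): every stratum is excluded by
# the formal Euler partner; Casals–Teixeira da Costa's Proposition 3.8 for EVERY spin

HONEST FRAMING (venture `Summits/Ventures/KdS`, cell `pub-kds`; LIT-1 g22 under lead ruling A86,
recipe `theory/P1-HANDOFF-g5.md §RESIDUAL`). `RouteWSpinFlipProp38.lean` proved the conclusion of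
the cited fact `CasalsTeixeiraDaCosta2022_partialModeStabilityProp38` (H3) for every half-integer
spin `s ≤ 2` and left, for `s ≥ 5/2`, the NON-EXTREME strata of the cosmological lattice
(`Re ω = mϖ₂`, `Im ω = jκ₂`, `0 < Im ω ≤ (s−2)κ₂`), where the kernel of the Teukolsky–Starobinsky
map consists of `weight × polynomial of positive degree`. This file closes ALL lattice strata at
once (`radial_vanishing_lattice`), uniformly in the stratum: by `spinFlip_polynomial` the
Hatsuda-gauge function is `x^{1−γ}(z_r−x)^{1−ε}·r(x)` with `r` a polynomial; in Casals–Teixeira da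
Costa's Euler gauge (`GeneralHeun.mobiusV`, `accessoryIdentity_holds`) this is the
Frobenius-polynomial function `v = Σ_k a_k (w−1)^{ρ+k}`, `ρ = 2η₁ − s` (`mobiusV_eq_cpow_mul_eval`,
`cpow_mul_eval_eq_cpowSum`); its
three-term recurrence (`SpinFlipFrobenius`) transfers termwise (`SpinFlipIntertwine`) to the partner
`ṽ = Σ_k b_k (w−1)^{2(η₀+η₁)+k}`, a solution of the `m₂ ↔ m₃`-SWAPPED Euler-gauge equation
(Takemura's map with exponent `η = α`, `euler_swap_*`) carrying the mode-data branches; the landed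
`gaugeGlue_holds` and `swappedEnergyVanishing_holds` (energy identity of CTdC's Thm 3.10 Step 2)
force `ṽ ≡ 0`, hence `b ≡ 0`, hence — off the resonances `ρ+1+i = 0` (excluded off the event
threshold ray `Re ω = mϖ₁`) and `2(η₀+η₁)+1+i = 0` (excluded by the pair condition `p₃`) — `a ≡ 0`,
`v ≡ 0`, `R ≡ 0`. A direct proof, no partner guessing; for `j = 2s−1` it re-proves the extreme
stratum of `RouteWSpinFlipLattice.lean`.

CONSEQUENCES (0 cited facts): `radial_vanishing_halfInt` — CTdC Prop. 3.8's conclusion for EVERY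
half-integer spin `s ≥ 1/2` on the whole open upper half-plane, under `Im(λ̄ω̄) ≤ 0`,
`|ω| ∉ |m|(0,Ω_SR)`, `p₃`, and the pair condition `p₁` for `s − 2η₁` (used only ON the event ray,
where it reads `Im ω > (s−1)κ₁` and the landed `radial_vanishing_of_im_gt` applies);
`prop38_allSpins` (every `s ∈ ½ℤ`); and **`partialModeStabilityProp38_holds :
CasalsTeixeiraDaCosta2022_partialModeStabilityProp38`** — the cited Literature fact H3 is now a
THEOREM of the tree (its binders `|a| < 3/Λ`, `m − s ∈ ℤ`, `Σm_j ∉ ℤ_{≥2}`, `p₂`, `p₄` are not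
used). THE TYPED RESIDUAL `RouteW.NonExtremeStrata` (P1 g5, `RouteWSpinFlipResidual.lean`
@e943ebba68d4) omits `p₁`; T3 does NOT route through `prop38_of_nonExtremeStrata`: at the
doubly-resonant lattice points `Re ω = mϖ₁ ∧ (j−s)κ₂ = (s−1−i₀)κ₁` (forcing `m(ϖ₁−ϖ₂) = 0`) the
weights `W_k`, `k > i₀`, vanish (`ρ = −(i₀+1)`: the branch `(w−1)^ρ` collides with the analytic
exponent), polynomial Euler-gauge candidates of degree `D−1−i₀` survive the partner argument, and it
is exactly H3's `p₁` (`Im ω > (s−1)κ₁` on the event ray) that excludes them; the corrected interface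
is `nonExtremeStrata_offEventRay`. No claim beyond these displayed statements.

(Verbatim declaration-level port — the declarations listed in the Part header count — of the Summits-side module of the KdS
venture; venture / cell / ruling bookkeeping in the text above is historical.)
-/

section Part7

open _root_.Set _root_.Complex _root_.Filter _root_.Topology _root_.Finset _root_.Polynomial

namespace Literature.Geometry.Lorentzian.KerrDeSitter.TeukolskyRadial

namespace RouteW

open Literature.Analysis.ODE Literature.Analysis.ODE.GeneralHeun
open Literature.Geometry.Lorentzian Literature.Geometry.Lorentzian.KerrDeSitter
open SpinFlipTS

/-! ### Every lattice stratum is excluded -/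

/-- **CTdC Prop. 3.8's conclusion at EVERY point of the cosmological lattice, off the event
threshold ray.** For subextremal `(M,a,Λ)`, `0 ≤ a`, `2s = N ≥ 1`, `Im ω > 0`, `Im(λ̄ω̄) ≤ 0`,
`|ω| ∉ |m|(0,Ω_SR)`, the pair condition for `−2(η₁+η₀)`, `Re ω ≠ mϖ₁`, and
`s + 2B(r_c) = j ∈ ℕ` with `j + 1 ≤ N`: every generic-boundary radial Teukolsky solution of spin `s`
vanishes on `(r₊, r_c)` (the image of `spinFlip_polynomial` vanishes by route W; the Euler-gauge
function `Σ_{k≤D} a_k (w−1)^{ρ+k}` of `R` has the formal Euler partner `Σ b_k (w−1)^{2(η₀+η₁)+k}`,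
a swapped-equation mode datum killed by `gaugeGlue_holds` + `swappedEnergyVanishing_holds`; the
weights do not vanish: `Im ρ ≠ 0` off the event ray, `2(η₀+η₁) ∉ −ℕ₊` by `p₃`). PROVED, 0 facts.
[cite: CasalsTeixeiradacosta2022, Proposition 3.8 (arXiv v2) with Lemma 3.5 and the proof of Theorem 3.10, Step 2 (route W / spin-flip bookkeeping of the in-tree proof)] -/
theorem radial_vanishing_lattice {M a Λ s : ℝ} {ω : ℂ} {m : ℝ} {lam : ℂ} {R : ℝ → ℂ}
    (hsub : IsSubextremal M a Λ) (ha : 0 ≤ a) {N : ℕ} (hN1 : 1 ≤ N) (hsN : 2 * s = N)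
    (hω : 0 < ω.im) (hlam : (lambdaBar a Λ s ω m lam * (starRingEnd ℂ) ω).im ≤ 0)
    (hSR : ¬(0 < ‖ω‖ ∧ ‖ω‖ < |m| * superradiantUpper M a Λ))
    (hp₃ : PairCondition (-2 * (etaEvent M a Λ ω m + etaCauchy M a Λ ω m)))
    (hray : ω.re ≠ m * horizonAngVel a (rPlus M a Λ))
    {j : ℕ} (hjN : j + 1 ≤ N) (hlat : (s : ℂ) + 2 * horizonB M a Λ ω m (rCosmo M a Λ) = (j : ℂ))
    (hR : IsRadialTeukolskySolution M a Λ s ω m lam R) (hin : IsIngoingAtEventHorizon M a Λ s ω m R)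
    (hout : IsOutgoingAtCosmoHorizon M a Λ ω m R) :
    ∀ r ∈ Ioo (rPlus M a Λ) (rCosmo M a Λ), R r = 0 := by
  -- (0) the spin-flip image vanishes by route W; the Hatsuda function is `x^{1−γ}(z_r−x)^{1−ε}·r`
  obtain ⟨R', hR', hin', hout', hpoly⟩ :=
    spinFlip_polynomial M a Λ s ω m lam R N hsub hN1 hsN hR hin hout
  have hN' : (1 : ℝ) ≤ N := by exact_mod_cast hN1
  have hs' : -s < 1 := by linarith
  have hlam' : (lambdaBar a Λ (-s) ω m (lamFlip a Λ s lam) * (starRingEnd ℂ) ω).im ≤ 0 := by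
    rw [lambdaBar_lamFlip]; exact hlam
  have hR'0 := radial_vanishing_lt_one hsub ha hs' hω hlam' hSR hp₃ hR' hin' hout'
  obtain ⟨r, hrdeg, hyr⟩ := hpoly hR'0 j hjN hlat
  -- abbreviations
  set η₀ := etaCauchy M a Λ ω m with hη₀
  set η₁ := etaEvent M a Λ ω m with hη₁
  set η₂ := etaCosmo M a Λ ω m with hη₂
  set z₂ := zTwo M a Λ with hz₂def
  set zr := mobiusZr M a Λ with hzrdef
  have hz₂ : 1 < z₂ := one_lt_zTwo hsub
  have hzr1 : 1 < zr := one_lt_mobiusZr hsub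
  have hzr0 : 0 < zr := by linarith
  have hA' : zr / (zr - 1) = z₂ := mobiusA_mobiusZr hsub
  set D : ℕ := N - 1 - j with hDdef
  have hDj : D + j + 1 = N := by omega
  have hrD : r.natDegree ≤ D := by omega
  set y : ℝ → ℂ := fun x => R (mobiusInv M a Λ x) / heunWeight M a Λ s ω m (mobiusInv M a Λ x)
    with hy
  -- (1) the Euler-gauge equation for `v = z^{−σ₋} y(z_r(z−1)/z)` on `(1, z₂)`
  have hysol := heunSolution_of_isRadialTeukolskySolution hsub hR
  have hV : ∀ z ∈ Ioo 1 z₂, 0 < z ∧ mobiusX zr z ∈ Ioo (0 : ℝ) 1 := by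
    intro z hz
    obtain ⟨hz1, hzz⟩ := hz
    have hz0 : 0 < z := by linarith
    refine ⟨hz0, ?_, ?_⟩
    · unfold mobiusX
      exact div_pos (mul_pos hzr0 (by linarith)) hz0
    · unfold mobiusX
      rw [div_lt_one hz0]
      rw [← hA'] at hzz
      have h1 : z * (zr - 1) < zr := (lt_div_iff₀ (by linarith)).mp hzz
      nlinarith
  have hmob := isSolutionOn_mobius (heun_fuchs hsub s ω m) (ne_of_gt hzr1) hV hysol
  rw [accessoryIdentity_holds M a Λ s ω m lam hsub, mobiusβ_eq hsub, mobiusγ_eq hsub,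
    heunGamma_eq hsub, heunDelta_eq hsub, heunSigmaMinus_eq hsub, hzrdef, mobiusA_mobiusZr hsub]
    at hmob
  -- the Euler-gauge parameters
  set m₁ := mass₁ M a Λ s ω m with hm₁
  set m₂ := mass₂ M a Λ ω m with hm₂
  set m₃ := mass₃ M a Λ s ω m with hm₃
  set m₄ := mass₄ M a Λ ω m with hm₄
  set E := bigE M a Λ s ω m lam with hE
  set ρ : ℂ := 2 * η₁ - (s : ℂ) with hρdef
  set η : ℂ := eulerGaugeα m₂ m₃ with hηdef
  have hF := eulerGauge_fuchs m₁ m₂ m₃ m₄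
  have hroot : (η - eulerGaugeα m₂ m₃) * (η - eulerGaugeβ m₂ m₄) = 0 := by rw [hηdef]; ring
  have hρ : ρ = 1 - eulerGaugeδ m₁ m₂ := by
    rw [hm₁, hm₂]; unfold mass₁ mass₂; rw [eulerGaugeδ_eta]; ring
  have hηval : η = 1 + (s : ℂ) + 2 * η₀ := by
    rw [hηdef, hm₂, hm₃]; unfold mass₂ mass₃; rw [eulerGaugeα_eta]
  -- (2) the explicit Frobenius-polynomial form of `v` on `(1, z₂)`
  set c₀ : ℂ := eulerKernel (heunGamma M a Λ s ω m + heunEps M a Λ s ω m - 2) zr with hc₀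
  set A : Polynomial ℂ := shiftPoly zr D r with hAdef
  set aC : ℕ → ℂ := fun k => c₀ * A.coeff k with haC
  have hAdeg : A.natDegree ≤ D := shiftPoly_natDegree_le zr D r
  have hκ : heunGamma M a Λ s ω m + heunEps M a Λ s ω m - 2 - heunSigmaMinus M a Λ s ω m = (D : ℂ) := by
    have hFH := heun_fuchs hsub s ω m
    have hσ : heunSigmaPlus s = (N : ℂ) + 1 := by
      have := two_sub_sigmaPlus s hsN; linear_combination -this
    have hδ : heunDelta M a Λ s ω m = (j : ℂ) + 1 := by
      have := delta_sub_one M a Λ s ω m; rw [hlat] at this; linear_combination this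
    have hDc : (D : ℂ) = (N : ℂ) - 1 - (j : ℂ) := by
      have : ((D + j + 1 : ℕ) : ℂ) = (N : ℂ) := by rw [hDj]
      push_cast at this; linear_combination this
    rw [hDc]; linear_combination hFH + hσ - hδ
  have hκ' : heunGamma M a Λ s ω m + heunEps M a Λ s ω m - 2 - η = (D : ℂ) := by
    rw [hηdef, hm₂, hm₃, ← heunSigmaMinus_eq hsub s ω m]; exact hκ
  have hγρ : 1 - heunGamma M a Λ s ω m = ρ := by rw [hρdef, hη₁]; exact one_sub_heunGamma hsub s ω m
  have hv_eq : ∀ w ∈ Ioo 1 z₂, mobiusV zr η y w = cpowSum ρ aC (D + 1) w := by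
    intro w hw
    obtain ⟨-, hx⟩ := hV w hw
    rw [mobiusV_eq_cpow_mul_eval hzr0 hrD hκ' hyr hw.1 hx, hγρ]
    exact cpow_mul_eval_eq_cpowSum hAdeg c₀ ρ hw.1
  have hsolF : IsSolutionOn (z₂ : ℂ) (eulerGaugeα m₂ m₃) (eulerGaugeβ m₂ m₄) (eulerGaugeγ m₁ m₂)
      (eulerGaugeδ m₁ m₂) (eulerGaugeε m₃ m₄) (eulerGaugeQ m₁ m₂ m₃ m₄ E (z₂ : ℂ)) (Ioo 1 z₂)
      (cpowSum ρ aC (D + 1)) :=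
    SpinFlipTS.IsSolutionOn.congr_eqOn isOpen_Ioo hmob fun w hw => hv_eq w hw
  -- (3) the formal Euler partner solves the swapped equation
  have haC0 : ∀ k, D < k → aC k = 0 := by
    intro k hk
    simp only [haC]
    rw [coeff_eq_zero_of_natDegree_lt (lt_of_le_of_lt hAdeg hk), mul_zero]
  set b : ℕ → ℂ := partnerCoeff ρ η D aC with hbdef
  set ρt : ℂ := 2 * (η₀ + η₁) with hρt
  have hρt' : ρ + η - 1 = ρt := by rw [hηval, hρdef, hρt]; ring
  have hpart := isSolutionOn_partner hz₂ hF hroot hρ haC0 hsolF z₂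
  rw [hηdef, euler_swap_α, euler_swap_β, euler_swap_γ, euler_swap_δ, euler_swap_ε, euler_swap_q,
    ← hηdef, hρt'] at hpart
  -- (4) mode data of the partner, gauge glue, energy identity
  have hdata := heunModeData_cpowSum hz₂ hpart
  obtain ⟨Rt, hRt, hRtinj⟩ := gaugeGlue_holds z₂ m₁ m₃ m₂ m₄ E ρt _ hz₂ hdata
  have he₁ : ρt + eulerGaugeδ m₁ m₃ / 2 = 1 / 2 + etaCauchy M a Λ ω m + etaEvent M a Λ ω m := by
    rw [hm₁, hm₃]; unfold mass₁ mass₃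
    rw [eulerGaugeδ_swap_eta, hρt, hη₀, hη₁]
    ring
  have he₂ : eulerGaugeε m₂ m₄ / 2 = 1 / 2 - etaCauchy M a Λ ω m - etaCosmo M a Λ ω m := by
    rw [hm₂, hm₄]; unfold mass₂ mass₄
    rw [eulerGaugeε_swap_eta]
    ring
  rw [he₁, he₂] at hRt
  have hsub' := hsub
  obtain ⟨hM, hΛ, h01, h12, -⟩ := hsub'
  have hr₀ : 0 ≤ rMinus M a Λ := rMinus_nonneg M a Λ
  have hcoef : ∀ z ∈ Ioo 1 z₂,
      sqcdCoeff m₁ m₃ m₂ m₄ E (z₂ : ℂ) z = tildeCoeff M a Λ s ω m lam z := by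
    intro z hz
    obtain ⟨hz1, hzz⟩ := hz
    rw [hm₁, hm₂, hm₃, hm₄, hE]
    unfold tildeCoeff bigE mass₁ mass₂ mass₃ mass₄
    rw [hz₂def] at hzz ⊢
    unfold zTwo
    symm
    refine ctdcTilde_eq_sqcd_swap (s : ℂ) η₀ η₁ η₂ (ltBlock M a Λ s ω m lam) ?_ ?_ ?_ ?_ ?_ ?_ ?_
    · exact_mod_cast (sub_pos.mpr h01).ne'
    · have : 0 < rCosmo M a Λ + (rMinus M a Λ + rPlus M a Λ + rCosmo M a Λ) := by linarith
      exact_mod_cast this.ne'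
    · have : 0 < rPlus M a Λ + rCosmo M a Λ := by linarith
      exact_mod_cast this.ne'
    · have : (0 : ℝ) < z := by linarith
      exact_mod_cast this.ne'
    · exact sub_ne_zero.mpr (by exact_mod_cast (ne_of_gt hz1))
    · unfold zTwo at hzz
      exact sub_ne_zero.mpr (by exact_mod_cast (ne_of_gt hzz))
    · rw [hz₂def] at hz₂
      unfold zTwo at hz₂
      have : (0 : ℝ) < ctdcZ₂ (rMinus M a Λ) (rPlus M a Λ) (rCosmo M a Λ) := by linarith
      exact_mod_cast this.ne'
  have hRt' : NormalFormModeData z₂ (tildeCoeff M a Λ s ω m lam)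
      (1 / 2 + etaCauchy M a Λ ω m + etaEvent M a Λ ω m)
      (1 / 2 - etaCauchy M a Λ ω m - etaCosmo M a Λ ω m) Rt := hRt.congr hcoef
  have hRt0 := swappedEnergyVanishing_holds M a Λ s ω m lam Rt hsub ha hω hlam hSR hRt'
  have hvt0 : ∀ w ∈ Ioo 1 z₂, cpowSum ρt b (D + 1) w = 0 := hRtinj hRt0
  -- (5) `b ≡ 0`, the weights do not vanish, `a ≡ 0`
  have hb0 := coeff_eq_zero_of_cpowSum_eq_zero hz₂ hvt0
  have hκ₁ := surfaceGravity_rPlus_pos hsub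
  have h1 : ∀ i : ℕ, ρ + 1 + i ≠ 0 := by
    intro i h
    have him := congrArg Complex.im h
    simp only [hρdef, Complex.add_im, Complex.sub_im, Complex.mul_im, Complex.ofReal_im,
      Complex.natCast_im, Complex.one_im, Complex.zero_im, hη₁, etaEvent_im,
      Complex.re_ofNat, Complex.im_ofNat] at him
    have : ω.re - m * horizonAngVel a (rPlus M a Λ) = 0 := by
      have h2 : (2 : ℝ) * surfaceGravity M a Λ (rPlus M a Λ) ≠ 0 := by positivity
      field_simp at him
      linarith
    exact hray (sub_eq_zero.mp this)
  have h2 : ∀ i : ℕ, ρ + η + i ≠ 0 := by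
    intro i h
    have hnr := nonres_of_pairCondition (η₀ := η₀) (η₁ := η₁) (by rw [hη₀, hη₁]; exact hp₃) i
    apply hnr
    rw [hηval, hρdef] at h
    linear_combination h
  have ha0 : ∀ k, aC k = 0 := by
    intro k
    by_cases hk : k < D + 1
    · exact eq_zero_of_partnerCoeff_eq_zero h1 h2 (hb0 k hk)
    · exact haC0 k (by omega)
  -- (6) `v ≡ 0` on `(1, z₂)`, hence `R ≡ 0` on `(r₊, r_c)`
  have hv0 : ∀ w ∈ Ioo 1 z₂, mobiusV zr η y w = 0 := by
    intro w hw
    rw [hv_eq w hw]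
    unfold cpowSum
    exact sum_eq_zero fun k _ => by rw [ha0 k, zero_mul]
  intro rr hr
  have hx := mobiusZ_mem_Ioo hsub hr
  set x := mobiusZ M a Λ rr with hxdef
  obtain ⟨hx0, hx1⟩ := hx
  have hzx : 0 < zr - x := by linarith
  have hw1 : 1 < zr / (zr - x) := by rw [lt_div_iff₀ hzx]; linarith
  have hw2 : zr / (zr - x) < z₂ := by
    rw [← hA', div_lt_div_iff_of_pos_left hzr0 hzx (by linarith)]
    linarith
  have hX : mobiusX zr (zr / (zr - x)) = x := by
    unfold mobiusX
    field_simp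
    ring
  have h0 := hv0 _ ⟨hw1, hw2⟩
  simp only [mobiusV] at h0
  rw [hX] at h0
  rcases mul_eq_zero.mp h0 with hk | hyx
  · exact absurd hk (eulerKernel_ne_zero _ _)
  · have hrm : rr ≠ rMinus M a Λ := by
      intro h; rw [h] at hr; exact absurd hr.1 (by linarith)
    have hinv := mobiusInv_mobiusZ hsub hrm
    simp only [hy, hxdef] at hyx
    rw [hinv] at hyx
    rcases div_eq_zero_iff.mp hyx with hR0 | hw0
    · exact hR0
    · exact absurd hw0 (heunWeight_ne_zero hsub s ω m hr)

/-! ### Casals–Teixeira da Costa's Proposition 3.8 for every spin -/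

/-- **CTdC Prop. 3.8's conclusion for EVERY half-integer spin `s ≥ 1/2` on the open upper
half-plane.** Hypotheses: subextremal, `0 ≤ a`, `2s = N ≥ 1`, `Im ω > 0`, `Im(λ̄ω̄) ≤ 0`,
`|ω| ∉ |m|(0,Ω_SR)`, and Prop. 3.8's pair conditions for `s − 2η₁` (`p₁`) and `−2(η₁+η₀)` (`p₃`).
Above `(s−1)κ₁`: `radial_vanishing_of_im_gt`; off the lattice: `radial_vanishing_offLattice`; on
the lattice: `radial_vanishing_lattice` — there `Re ω = mϖ₂`, and the event ray `Re ω = mϖ₁` is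
excluded because on it `p₁` says `Im ω > (s−1)κ₁`. PROVED, 0 cited facts.
[cite: CasalsTeixeiradacosta2022, Proposition 3.8 (arXiv v2) with Lemma 3.5 and the proof of Theorem 3.10, Step 2 (route W / spin-flip bookkeeping of the in-tree proof)] -/
theorem radial_vanishing_halfInt {M a Λ s : ℝ} {ω : ℂ} {m : ℝ} {lam : ℂ} {R : ℝ → ℂ}
    (hsub : IsSubextremal M a Λ) (ha : 0 ≤ a) {N : ℕ} (hN1 : 1 ≤ N) (hsN : 2 * s = N)
    (hω : 0 < ω.im) (hlam : (lambdaBar a Λ s ω m lam * (starRingEnd ℂ) ω).im ≤ 0)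
    (hSR : ¬(0 < ‖ω‖ ∧ ‖ω‖ < |m| * superradiantUpper M a Λ))
    (hp₁ : PairCondition ((s : ℂ) - 2 * etaEvent M a Λ ω m))
    (hp₃ : PairCondition (-2 * (etaEvent M a Λ ω m + etaCauchy M a Λ ω m)))
    (hR : IsRadialTeukolskySolution M a Λ s ω m lam R) (hin : IsIngoingAtEventHorizon M a Λ s ω m R)
    (hout : IsOutgoingAtCosmoHorizon M a Λ ω m R) :
    ∀ r ∈ Ioo (rPlus M a Λ) (rCosmo M a Λ), R r = 0 := by
  by_cases hhi : (s - 1) * surfaceGravity M a Λ (rPlus M a Λ) < ω.im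
  · exact radial_vanishing_of_im_gt hsub ha hhi hω hlam hSR hp₃ hR hin hout
  by_cases hoff : OffLattice M a Λ s ω m
  · exact radial_vanishing_offLattice hsub ha hN1 hsN hω hlam hSR hp₃ hoff hR hin hout
  -- on the lattice: `s + 2B(r_c) = j`, `1 ≤ j ≤ N − 1`
  obtain ⟨j, hj, hj'⟩ : ∃ j : ℤ, (j : ℝ) ≤ 2 * s - 1 ∧
      (s : ℂ) + 2 * horizonB M a Λ ω m (rCosmo M a Λ) = j := by
    by_contra h
    exact hoff fun j hj hj' => h ⟨j, hj, hj'⟩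
  have hκ₂ := surfaceGravity_rCosmo_pos hsub
  have hκ₁ := surfaceGravity_rPlus_pos hsub
  have hre := congrArg Complex.re hj'
  rw [horizonB_rCosmo_eq_neg_etaCosmo hsub] at hre
  simp [etaCosmo_re] at hre
  have hN' : (1 : ℝ) ≤ N := by exact_mod_cast hN1
  have hs0 : 0 < s := by linarith
  have hquot : 0 < ω.im / (2 * surfaceGravity M a Λ (rCosmo M a Λ)) := div_pos hω (by positivity)
  have hj0 : (0 : ℝ) < j := by linarith
  obtain ⟨j₀, hj₀⟩ : ∃ j₀ : ℕ, (j₀ : ℤ) = j := ⟨j.toNat, Int.toNat_of_nonneg (by exact_mod_cast hj0.le)⟩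
  have hj₀N : j₀ + 1 ≤ N := by
    have h1 : ((j₀ : ℤ) : ℝ) ≤ 2 * s - 1 := by rw [hj₀]; exact hj
    have h2 : (j₀ : ℝ) + 1 ≤ (N : ℝ) := by push_cast at h1; linarith
    exact_mod_cast h2
  have hlat : (s : ℂ) + 2 * horizonB M a Λ ω m (rCosmo M a Λ) = (j₀ : ℂ) := by
    rw [hj']
    have : ((j : ℤ) : ℂ) = ((j₀ : ℕ) : ℂ) := by rw [← hj₀]; norm_cast
    exact this
  -- off the event ray, by `p₁` and `¬hhi`
  have hray : ω.re ≠ m * horizonAngVel a (rPlus M a Λ) := by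
    intro heq
    have him : ((s : ℂ) - 2 * etaEvent M a Λ ω m).im = 0 := by
      simp [etaEvent_im, heq]
    have h := hp₁ him
    simp [etaEvent_re] at h
    have h2 : 2 * (ω.im / (2 * surfaceGravity M a Λ (rPlus M a Λ))) =
        ω.im / surfaceGravity M a Λ (rPlus M a Λ) := by field_simp
    have h3 : s - 1 < ω.im / surfaceGravity M a Λ (rPlus M a Λ) := by linarith
    exact hhi ((lt_div_iff₀ hκ₁).mp h3)
  exact radial_vanishing_lattice hsub ha hN1 hsN hω hlam hSR hp₃ hray hj₀N hlat hR hin hout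

/-- **H3 for every spin `s ∈ ½ℤ`**: the conclusion of
`CasalsTeixeiraDaCosta2022_partialModeStabilityProp38` under its binders subextremal, `0 ≤ a`,
`2s ∈ ℤ`, `Im ω > 0`, `Im(λ̄ω̄) ≤ 0`, `|ω| ∉ |m|(0,Ω_SR)`, `p₁`, `p₃` (the binders `|a| < 3/Λ`,
`m − s ∈ ℤ`, `Σm_j ∉ ℤ_{≥2}`, `p₂`, `p₄` are not needed). For `s < 1` this is route W
(`radial_vanishing_lt_one`); for `s ≥ 1`, `radial_vanishing_halfInt`. PROVED, 0 cited facts.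
[cite: CasalsTeixeiradacosta2022, Proposition 3.8 (arXiv v2) with Lemma 3.5 and the proof of Theorem 3.10, Step 2 (route W / spin-flip bookkeeping of the in-tree proof)] -/
theorem prop38_allSpins (M a Λ s : ℝ) (ω : ℂ) (m : ℝ) (lam : ℂ)
    (hsub : IsSubextremal M a Λ) (ha : 0 ≤ a) (h2s : ∃ k : ℤ, 2 * s = k) (hω : 0 < ω.im)
    (hlam : (lambdaBar a Λ s ω m lam * (starRingEnd ℂ) ω).im ≤ 0)
    (hSR : ¬(0 < ‖ω‖ ∧ ‖ω‖ < |m| * superradiantUpper M a Λ))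
    (hp₁ : PairCondition ((s : ℂ) - 2 * etaEvent M a Λ ω m))
    (hp₃ : PairCondition (-2 * (etaEvent M a Λ ω m + etaCauchy M a Λ ω m)))
    (R : ℝ → ℂ) (hR : IsRadialTeukolskySolution M a Λ s ω m lam R)
    (hin : IsIngoingAtEventHorizon M a Λ s ω m R) (hout : IsOutgoingAtCosmoHorizon M a Λ ω m R) :
    ∀ r ∈ Ioo (rPlus M a Λ) (rCosmo M a Λ), R r = 0 := by
  by_cases hs : s < 1
  · exact radial_vanishing_lt_one hsub ha hs hω hlam hSR hp₃ hR hin hout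
  · obtain ⟨k, hk⟩ := h2s
    have hk1 : (1 : ℤ) ≤ k := by
      have : (1 : ℝ) ≤ (k : ℝ) := by rw [← hk]; linarith
      exact_mod_cast this
    obtain ⟨N, hNk⟩ : ∃ N : ℕ, (N : ℤ) = k := ⟨k.toNat, Int.toNat_of_nonneg (by omega)⟩
    have hsN : 2 * s = (N : ℝ) := by
      rw [hk]; exact_mod_cast hNk.symm
    have hN1 : 1 ≤ N := by exact_mod_cast (hNk ▸ hk1 : (1 : ℤ) ≤ (N : ℤ))
    exact radial_vanishing_halfInt hsub ha hN1 hsN hω hlam hSR hp₁ hp₃ hR hin hout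

end RouteW

end Literature.Geometry.Lorentzian.KerrDeSitter.TeukolskyRadial

end Part7

/-! ## Part 8 — the EXACT discharge `CasalsTeixeiraDaCosta2022_partialModeStabilityProp38_holds` -/

namespace Literature.Geometry.Lorentzian.KerrDeSitter

open TeukolskyRadial TeukolskyRadial.RouteW

/-- **The named fact `CasalsTeixeiraDaCosta2022_partialModeStabilityProp38` HOLDS** (`KerrDeSitterThresholdRays.lean`; Casals–Teixeira da Costa 2022,
Prop. 3.8 with Lemma 3.5, proof of Cor. 3.9 and Thm. 3.10 Step 2: every generic-boundary radial Teukolsky solution with `Im ω > 0`,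
`Im(λ̄ω̄) ≤ 0`, `|ω| ∉ |m|(0,Ω_SR)` and the pair conditions vanishes).  EXACT-name discharge by `RouteW.prop38_allSpins` (route W — transfer,
Euler recursion, gauge glue, swapped energy identity — plus the spin flip off the cosmological lattice and the formal Euler partner on it; the
fact's binders `|a| < 3/Λ`, `m − s ∈ ℤ`, `Σ m_j ∉ ℤ_{≥2}`, `p₂`, `p₄` are not used).  Literature-side twin of the Summits-side
`Summit.Ventures.KdS.RouteW.partialModeStabilityProp38_holds` (same proof, 0 cited facts).
[cite: CasalsTeixeiradacosta2022, Proposition 3.8 (arXiv v2) with Lemma 3.5, proof of Corollary 3.9 and proof of Theorem 3.10 (Step 2)] -/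
theorem CasalsTeixeiraDaCosta2022_partialModeStabilityProp38_holds :
    CasalsTeixeiraDaCosta2022_partialModeStabilityProp38 := by
  intro M a Λ s ω m lam hsub ha _ h2s _ hω hlam hSR _ hp₁ _ hp₃ _ R hR hin hout
  exact prop38_allSpins M a Λ s ω m lam hsub ha h2s hω hlam hSR hp₁ hp₃ R hR hin hout

end Literature.Geometry.Lorentzian.KerrDeSitter

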